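import Literature.MathematicalPhysics.QuantumFieldTheory.Dimock2011to13.RedundantCharacteristicFunctions

/-!
# Dimock, *The renormalization group according to Balaban* II, §3.2: the ANALYTICITY DOMAINS `𝒫_k(□, δ)` (lamp), (scone3),
# «𝒮_k(□) ⊂ 𝒫_k(□, δ)»; §3.11.3 `\subsubsection{bounds for analyticity domains}`: `𝒫⁰_{k+1}(□, δ)` (startrek) and LEMMA 3.14
# `\label{technical}` with its Remark (somewhat) and proof cases (A)∕(B)∕(C), ASSEMBLED from the printed inputs on the
# tree's `ℤ^d` block geometry — the complex-valued twin of `SmallFieldBounds` ∕ `RedundantCharacteristicFunctions`, obtained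
# from ONE normed-space-valued predicate whose `E = ℝ` case is PROVABLY the tree's DEFINITION 3.s; (v1.1) §3.11.1 LEMMA 3.9
# `\label{singsong2}` item (2) FROM item (1): (ding) ⟹ (swish), (skunky2) ⟹ (tiny0) ⟹ (salt), the glued derivative; (v1.2) the
# fine-field domain `ℛ_k(X, ε)` (part II DEFINITION (rk) ∕ part I §3.2) TYPED over `E` with the lattice Hölder quotient, part I
# LEMMA `strong` (2) «φ_k ∈ ℛ_k» with its PRINTED smallness `p_k ≤ p!(2∕ε)^p λ_k^{−ε∕2}`, and part II's `½ℛ_k` memberships;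
# (v1.3) uniform bounds ⟹ `cℛ_k` (part I LEMMA 16 «𝒲_k ∈ λ_k^{1/4}ℛ_k»), complex multiples in `ℛ_k` and the analyticity disc of
# LEMMA 3.15 (A): `φ⁰ + t𝒲 ∈ ℛ_k` for all `|t| ≤ λ_k^{−1/4}`

**Citation header (reproduction of PUBLISHED work; template of the Bałaban lattice Yang–Mills cell).**
J. Dimock, *The renormalization group according to Balaban II. Large fields*, J. Math. Phys. **54** (2013) 092301
(= arXiv:1212.5562v2) [Dimock2013BalabanII], §3.2 `\subsection{bounds on fields}` (TeX L2048): `p_k`, `α_k` L2050–2058,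
DEFINITION 3.s `\label{s}` (yass1) L2063–2077, LEMMA 3.1 `\label{threeone}` L2103–2116 (proof (base1)∕(base2) L2121–2138),
the analyticity domains: DEFINITION (lamp) (the second `\begin{defn}` of §3.2) L2243–2258, (scone3) L2261–2266, *"Note
also that 𝒮_k(□) ⊂ 𝒫_k(□, δ)"* L2267, DEFINITION `𝒫′_k` L2269–2279, DEFINITION `𝒫_{k,Ω}` L2287–2291, DEFINITION (rk) `ℛ_k(X, ε)` (the
fifth `\begin{defn}` of §3.2) L2300–2314; §2.5 (dos) L1598–1601; §3.13 LEMMA 3.15 Remark 2 L4492–4493 and proof (A) L4500–4511;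
§3.18 L6084–6090; and part I = J. Dimock, *The renormalization group according to Balaban I. Small fields*, Rev. Math. Phys.
**25** (2013) 1330010 (= arXiv:1108.1335v2) [Dimock2013], §2.4 the Hölder quotient `δ_α` L917–927, §3.2 `\subsection{small
fields}` L1190–1284: DEFINITION `ℛ_k` L1230–1240, LEMMA `\label{strong}` L1244–1249 with proof L1252–1283, §4.3 LEMMA 16
`\label{11}` L2187–2193 with proof L2197–2215 (TeX `inputs/files/dimock/src/1108.1335/1108.1335.tex`, 4263 lines, sha256[:16]
7382e6540dded9be); §3.10 (not) L3610–3622;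
§3.7 (ding3) as quoted in §3.11.2 L4119–4123; §3.11 `\subsection{more estimates}` L3711, §3.11.1 `\subsubsection{bounds on the
fluctuation field}` L3714–3846: (go1)∕(go2) L3722–3728, LEMMA 3.9 `\label{singsong2}` (the ninth `\begin{lem}` of §3) L3738–3767
((not1) L3743–3749, (skunky2) L3751–3754, (swish) L3757–3759, (salt) L3762–3765) with its proof L3770–3845 ((ding) L3814–3818,
(tiny0) L3826–3834, the boundary-crossing paragraph L3837–3845); §3.11.3 `\subsubsection{bounds for
analyticity domains}` L4162–4322: L4164–4167, `𝒫⁰_{k+1}(□, δ)` (startrek) L4168–4179, LEMMA 3.14 `\label{technical}` (the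
fourteenth `\begin{lem}` of §3) L4188–4198, Remarks 1–2 L4200–4221 ((somewhat) L4202–4210), proof L4224–4322: case (A)
L4231–4289 ((lamp1) L4234–4238, (note9) L4241–4244, (lamp2) L4252–4256, (lamp3) L4258–4268, (note8) L4273–4276, (lamp4)
L4278–4284, the `Ψ̂^{loc}` sentence and the arithmetic L4285–4289), case (B) L4290–4311 ((substandard) L4297–4298, (lamp5)
L4303–4307, L4310), case (C) L4313–4320 ((lamp6) L4315–4319).  TeX line numbers refer to the arXiv source held by the cell
(`inputs/files/dimock/src/1212.5562/1212.5562.tex`, 7217 lines, sha256[:16] 75c5792fc48eacbc); every quotation below was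
read there this session.  Dimock's papers are published and refereed and are the cell's TEMPLATE, not manuscripts
under audit; no quantity of the Bałaban series is touched.

**What the paper prints (verbatim, TeX → Unicode).**  L2243–2258: *"Next we introduce an analyticity domain for our
fundamental fields.  DEFINITION. Let δ be a fixed small positive number. Let □ be an M-cube in Ω_k ⊂ 𝕋^{−k}_{M+N−k}. Define
𝒫_k(□, δ) to be all complex-valued (Φ_{k−1,δΩ_{k−1}}, Φ_{k,Ω_k}) satisfying:  |Φ_k − Q_kφ_{k,Ω(□)}| ≤ λ_k^{−1/4−δ} on □̃ ∩ Ω_k,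
|∂φ_{k,Ω(□)}| ≤ λ_k^{−1/4−δ} on □̃,  |φ_{k,Ω(□)}| ≤ λ_k^{−1/4−δ} on □̃  (lamp)  For X ⊂ Ω_k define 𝒫_k(X, δ) = ∩_{□⊂X}𝒫_k(□,
δ)"*.  L2261–2267: *"As in lemma threeone if the fields are in 𝒫_k(□) then on □̃ ∩ Ω_k  |Φ_k| ≤ 2λ_k^{−1/4−δ}  |∂Φ_k| ≤
3λ_k^{−1/4−δ}  (scone3)  Note also that 𝒮_k(□) ⊂ 𝒫_k(□, δ)."*  L4164–4179: *"In an expression like R_{k,Π}(Λ_k, Φ_{k,Λ_k−Ω_{k+1}}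
Ψ^{loc}_{k,Ω′} + (C^{1/2}_{k,Ω′})^{loc}W_k), we need to know how large we can allow the fundamental fields Φ_k, Φ_{k+1} to be, and
still stay in the region of analyticity 𝒫_k(Λ_k, 2δ) for R_{k,Π}(Λ_k). The following is a result in that direction. The proof
is similar to lemma vanishing.  Define for an LM-cube □ ⊂ Ω_{k+1} the domain 𝒫⁰_{k+1}(□, δ) to be all fields satisfying
|Φ_{k+1} − Q_{k+1}φ_{k+1,Ω⁺(□)}| ≤ λ_{k+1}^{−1/4−δ}L^{−1/2} on □̃ ∩ Ω_{k+1},  |∂φ_{k+1,Ω⁺(□)}| ≤ λ_{k+1}^{−1/4−δ}L^{−3/2} on □̃,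
|φ_{k+1,Ω⁺(□)}| ≤ λ_{k+1}^{−1/4−δ}L^{−1/2} on □̃  (startrek)  For X ⊂ Ω_{k+1} define 𝒫⁰_{k+1}(X, δ) = ∩_{□⊂X}𝒫⁰_{k+1}(□,
δ)"*.  LEMMA 3.14 (L4188–4198): *"If (Φ_{k,δΩ_k}, Φ_{k+1,Ω_{k+1}}) ∈ 𝒫′_k(Ω^♮_k − Ω_{k+1}, δ) ∩ 𝒫⁰_{k+1}(Ω_{k+1} − Ω^{2♮}_{k+1}, δ)
∩ 𝒫⁰_{k+1}(Ω^{2♮}_{k+1}, 2δ)  (sandy)  then  (Φ_{k,δΩ_k}, Ψ^{loc}_{k,Ω_{k+1}}(Ω′)) ∈ ½𝒫_k(Ω^♮_k, 2δ)"*.  Remark 1 (L4202–4218):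
*"On the domain (sandy) we have  |Φ_k| ≤ 2λ_k^{−1/4−δ} on Ω^♮_k − Ω_{k+1},  |Φ_{k+1}| ≤ 2λ_{k+1}^{−1/4−δ}L^{−1/2} on Ω_{k+1} −
Ω^{2♮}_{k+1},  |Φ_{k+1}| ≤ 2λ_{k+1}^{−1/4−2δ}L^{−1/2} on Ω^{2♮}_{k+1}  (somewhat) … Note also that 𝒫_k(Ω^♮_k, 2δ) is contained in
𝒫_k(Λ_k, 2δ)"*.  Proof (L4226–4231): *"For an M-cube □ ⊂ Ω^♮_k, we must show that (Φ_{k,δΩ_k}, Ψ^{loc}_{k,Ω_{k+1}}(Ω′)) ∈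
½𝒫_k(□, 2δ). We distinguish several cases. (A.) □ ⊂ Ω^♮_{k+1}"*; L4233–4256: *"Our assumptions imply that on □̃ (LM-cube
enlargement)  |Φ_{k+1} − Q_{k+1}φ⁰_{k+1,Ω⁺(□)}|, |∂φ⁰_{k+1,Ω⁺(□)}|, |φ⁰_{k+1,Ω⁺(□)}| ≤ λ_{k+1}^{−1/4−2δ}L^{−1/2}  (lamp1) … We
claim that on □̃  |φ⁰_{k+1,Ω(□)} − φ⁰_{k+1,Ω′}|, |∂φ⁰_{k+1,Ω(□)} − ∂φ⁰_{k+1,Ω′}| ≤ CM^{−1/2}λ_{k+1}^{−1/4−2δ}  (note9) … Given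
(note9), then for M large we can replace φ⁰_{k+1,Ω⁺(□)} by φ⁰_{k+1,Ω′} in (lamp1) and have on (Ω^♮_{k+1})^∼  |Φ_{k+1} −
Q_{k+1}φ⁰_{k+1,Ω′}|, |∂φ⁰_{k+1,Ω′}|, |φ⁰_{k+1,Ω′}| ≤ 2λ_{k+1}^{−1/4−2δ}L^{−1/2}  (lamp2)"*; L4258–4268: *"Now replace |Φ_{k+1} −
Q_{k+1}φ⁰_{k+1,Ω′}| by the smaller |Ψ_{k,Ω_{k+1}}(Ω′) − Q_kφ⁰_{k+1,Ω′}| and use the identity φ⁰_{k+1,Ω′} = φ_{k,Ω(Λ*_k)}(Ψ̂_{k,Ω′})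
which still holds with complex fields. This yields on (Ω^♮_{k+1})^∼  |Ψ_{k,Ω_{k+1}}(Ω′) − Q_kφ_{k,Ω(Λ*_k)}(Ψ̂_{k,Ω′})|,
|∂φ_{k,Ω(Λ*_k)}(Ψ̂_{k,Ω′})|, |φ_{k,Ω(Λ*_k)}(Ψ̂_{k,Ω′})| ≤ 2λ_{k+1}^{−1/4−2δ}L^{−1/2}  (lamp3)"*; L4270–4289: *"by a variation of
(note6) we have … on □̃ (M-cube enlargement):  |φ^{min}_{k,Ω(□)} − φ_{k,Ω(Λ*_k)}(Ψ̂_{k,Ω′})|, |∂φ^{min}_{k,Ω(□)} −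
∂φ_{k,Ω(Λ*_k)}(Ψ̂_{k,Ω′})| ≤ CM^{−1/2}λ_{k+1}^{−1/4−2δ}  (note8)  Hence for M large we can replace φ_{k,Ω(Λ*_k)}(Ψ̂_{k,Ω′}) by
φ^{min}_{k,Ω(□)} in (lamp3) and obtain on □̃  |Ψ_{k,Ω_{k+1}}(Ω′) − Q_kφ^{min}_{k,Ω(□)}|, |∂φ^{min}_{k,Ω(□)}|, |φ^{min}_{k,Ω(□)}| ≤
3λ_{k+1}^{−1/4−2δ}L^{−1/2}  (lamp4)  The same holds with Ψ̂_{k,Ω′} replaced by Ψ̂^{loc}_{k,Ω′} and 4λ_{k+1}^{−1/4−2δ}L^{−1/2} on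
the right side. But for L large, 4λ_{k+1}^{−1/4−2δ}L^{−1/2} = 4λ_k^{−1/4−2δ}L^{−3/4−2δ} ≤ ½λ_k^{−1/4−2δ}. Thus we have
Ψ^{loc}_{k,Ω_{k+1}}(Ω′) ∈ ½𝒫_k(□, 2δ) as required."*  Case (B) (L4290–4311): *"□ ⊂ Ω_{k+1} − Ω^♮_{k+1}. This time we take a
more direct approach. … on [(Ω^♮_{k+1})^c]^∼ ∩ Ω_{k+1} we have  |Ψ_{k,Ω_{k+1}}(Ω′)| ≤ Cλ_{k+1}^{−1/4−δ}  (substandard) … We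
claim that on □̃ (M-cube enlargement)  |Ψ_{k,Ω_{k+1}}(Ω′) − Q_kφ^{min}_{k,Ω(□)}|, |∂φ^{min}_{k,Ω(□)}|, |φ^{min}_{k,Ω(□)}| ≤
Cλ_{k+1}^{−1/4−δ}  (lamp5)  For example to bound |φ^{min}_{k,Ω(□)}| we need a bound on Ψ_{k,Ω_{k+1}}(Ω′) on □^{∼(2R+1)} ∩
Ω_{k+1}. But this is included in the LM enlargement in (substandard), assuming L > 2R+1. A bound of the same form holds with
Ψ_{k,Ω_{k+1}}(Ω′) replaced by Ψ^{loc}_{k,Ω_{k+1}}(Ω′). This gives the result since for λ_k sufficiently small Cλ_{k+1}^{−1/4−δ} ≤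
½λ_k^{−1/4−2δ}"*.  Case (C) (L4313–4320): *"□ ⊂ Ω^♮_k − Ω_{k+1}. Argue as in the previous case. Note that now we are
trying to prove on □̃  |Φ_k − Q_kφ^{min}_{k,Ω(□)}|, |∂φ^{min}_{k,Ω(□)}|, |φ^{min}_{k,Ω(□)}| ≤ ½λ_{k+1}^{−1/4−2δ}  (lamp6)"*.  LEMMA 3.9
(L3738–3767): *"The bracketed characteristic functions in (pinky0) enforce the following inequalities: 1. For an LM-cube □
⊂ Ω_{k+1}  |Φ_{k+1} − Q_{k+1}φ⁰_{k+1,Ω′}| ≤ Cp_k on □̃ ∩ Ω_{k+1},  |∂φ⁰_{k+1,Ω′}| ≤ Cp_k on □̃,  |φ⁰_{k+1,Ω′}| ≤ Cp_kα_k^{−1} on □̃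
(not1)  The same bounds hold for φ⁰_{k,Ω′}(s), φ⁰_{k,Ω′}(□*) and  |φ⁰_{k+1,Ω′}(□*) − φ⁰_{k+1,Ω′}| ≤ e^{−r_{k+1}}  (skunky2)  2. For □ ⊂
Ω_{k+1} we have on □̃ ∩ Ω_{k+1}  |Ψ_{k,Ω_{k+1}}(Ω′)| ≤ Cp_kα_k^{−1}   |∂Ψ_{k,Ω_{k+1}}(Ω′)| ≤ Cp_k  (swish)  The same holds for
Ψ_{k,Ω_{k+1}}(Ω′, s), Ψ_{k,Ω_{k+1}}(Ω′, □*) and Ψ^{loc}_{k,Ω_{k+1}}(Ω′) and  |δΨ_{k,Ω_{k+1}}(Ω′)| = |Ψ^{loc}_{k,Ω_{k+1}}(Ω′) − Ψ_{k,Ω_{k+1}}(Ω′)|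
≤ e^{−r_{k+1}}  (salt)"*; proof of (2), L3814–3835: *"The minimizer can be written  Ψ_{k,Ω_{k+1}}(Ω′) = Q_kφ⁰_{k+1,Ω′} + (aL^{−2}∕(a_k +
aL^{−2}))Q^T(Φ_{k+1} − Q_{k+1}φ⁰_{k+1,Ω′})  (ding)  We claim that on □̃ ∩ Ω_{k+1}  |Ψ| ≤ Cp_kα_k^{−1}  |∂Ψ| ≤ Cp_k  These follow more or
less directly from the bounds (not1). The bound |Q^T(Φ_{k+1} − Q_{k+1}φ⁰_{k+1,Ω′})| ≤ Cp_k, implies a bound of the same form on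
the derivative, since it is defined on a unit lattice. … We also have by (skunky2) on □̃ ∩ Ω_{k+1}  |Ψ_{k,Ω_{k+1}}(Ω′, □*) −
Ψ_{k,Ω_{k+1}}(Ω′)| = |Q_k(φ⁰_{k+1,Ω′}(□*) − φ⁰_{k+1,Ω′}) − (aL^{−2}∕(a_k + aL^{−2}))Q^TQ_{k+1}(φ⁰_{k+1,Ω′}(□*) − φ⁰_{k+1,Ω′})| ≤ e^{−r_{k+1}}
(tiny0)  This implies the bound on Ψ^{loc}_{k,Ω_{k+1}}(Ω′) − Ψ_{k,Ω_{k+1}}(Ω′)"*; L3837–3845: *"Finally we need the bound |∂Ψ^{loc}| ≤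
Cp_k. There is a potential problem here when the derivative crosses the boundary of a cube □. Suppose □₁, □₂ are adjacent cubes
and x ∈ □₁ ∩ Ω^{(k)}_{k+1} and x + e_μ ∈ □₂ ∩ Ω^{(k)}_{k+1}. We need to show |Ψ(Ω′, □₂*, x + e_μ) − Ψ(Ω′, □₁*, x)| ≤ Cp_k. However just
as in (tiny0) one can show |Ψ(Ω′, □₁*, x) − Ψ(Ω′, □₂*, x)| ≤ e^{−r_{k+1}}. This reduces the estimate to |∂Ψ(Ω′, □₂*, x)| ≤ Cp_k,
which we know since we control this derivative on □̃₂."*  DEFINITION (rk) (part II L2300–2314): *"We also define a domain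
of analyticity for fields on the fine lattice 𝕋^{−k}_{M+N−k}, as in part I.  DEFINITION. Let ε > 2δ be a fixed small positive number
and X ⊂ 𝕋^{−k}_{M+N−k}. Then ℛ_k = ℛ_k(X, ε) is all functions φ : X → ℂ such that:  |φ| < λ_k^{−1/4−3ε},  |∂φ| < λ_k^{−1/4−2ε},  |δ_α∂φ| <
λ_k^{−1/4−ε}  (rk)"*; part I L922–927: *"Here δ_α is defined for d(x,x′) ≤ 1 by (δ_αf)(x,x′) = (f(x) − f(x′))∕d(x,x′)^α"*; part I
LEMMA `strong` (L1244–1249): *"Let Φ_k ∈ 𝒮_k. Then 1. |Φ_k| ≤ 2p_kλ_k^{−1/4} and |∂_μΦ_k| ≤ 3p_k. 2. For λ_k sufficiently small φ_k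
= a_kG_kQ^T_kΦ_k ∈ ℛ_k."*, proof of (2) L1266–1283: *"For the second point if λ_k is small we have p_k ≤ λ_k^{−ε} since p_k = (−log
λ_k)^p ≤ p!(2∕ε)^p e^{½ε(−log λ_k)} = p!(2∕ε)^p λ_k^{−ε∕2} ≤ λ_k^{−ε}  The bounds on φ_k, ∂φ_k follow directly. Furthermore by (gk2)
and ‖Q_k^TΦ_k‖_∞ ≤ ‖Φ_k‖_∞ and p_k ≤ 𝒪(1)λ_k^{−ε∕2}  |δ_α∂φ_k| = |a_kδ_α∂G_kQ_k^TΦ_k| ≤ C‖Φ_k‖_∞ ≤ Cp_kλ_k^{−1/4} ≤ λ_k^{−1/4−ε}"*;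
part II LEMMA 3.15 Remark 2 (L4492–4493): *"The bounds (dos) and (somewhat) and 2δ < ε yield |φ⁰_{k+1,Ω′}| ≤ Cλ_k^{−1/4−2δ} ≤
½λ_k^{−1/4−3ε} with similar bounds on derivatives. Thus φ⁰_{k+1,Ω′} is in ½ℛ_k as required."*; §3.18 L6084–6090: *"|φ_{k+1,Ω′}|
≤ Cλ_{k+1}^{−1/4−2δ} with similar bounds on the derivatives. Then φ_{k+1,Ω′,L} and its derivatives satisfy the same bounds and
since 2δ < ε these are more than sufficient to guarantee that φ_{k+1,Ω′,L} ∈ ½ℛ_k"*.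

**Why this module.**  TEMPLATE.md §4.2 row «D2 §3.10 new characteristic functions» lists §3.11.3 among the items that
*"spell out what B14 leaves implicit"* (B14 p. 245: *"Many new characteristic functions appear in connection with large
field regions, and they play an important, although quite technical, role"*).  After gen 38's `RedundantCharacteristicFunctions`
(LEMMAS 3.11, 3.13) the §3.11 bookkeeping layer lacked only LEMMA 3.14, recorded by that seat as BLOCKED: *"the domains
𝒫_k are complex-field classes while `SmallFieldBounds.qavg`∕`LocalSmallField` are ℝ-valued; needs `SmallFieldBounds`
generalised (or a ℂ twin) first — do NOT re-declare notions"* (HANDOFF «gen 38 SEAT CLOSED», NEXT (i); and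
`SmallFieldBounds`' own header, reading (iv): *"Fields are real-valued as in (yass1); the complex domains 𝒫_k, ℛ_k are not
treated"*).  This module supplies the missing carrier WITHOUT touching `SmallFieldBounds` and without a second copy of
DEFINITION 3.s: ONE predicate `LocalFieldBounds n q α S₀ S Φ φ` for pairs of fields with values in a real normed space `E`
— the three bounds of (yass1)∕(lamp)∕(startrek) have the same shape and differ only in the constants and in `E` — whose
`E = ℝ` instance is PROVED equal to `SmallFieldBounds.LocalSmallField` (`localFieldBounds_real_iff`) and whose complexified
real pairs are PROVED to satisfy the same bounds (`localFieldBounds_ofReal_iff`); the printed complex domains are then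
`PDomain` = (lamp) and `PDomain0` = (startrek) at `E = ℂ`, and LEMMA 3.14's proof is the same replacement algebra as
LEMMA 3.13's background half (gen 38, ℝ-valued), re-run over `E`.

**What is reproduced here (kernel-checked, zero `sorry`).**  Carrier: the tree's `ℤ^d` block geometry
(`Balaban1983to89.B6QGQLower276`: `X d`, `blk`, `B n y`, `U n S`, `chart`; `BlockAveragingComposition.blk_blk` ∕
`RedundantCharacteristicFunctions.U_comp` for the two-level structure unit cubes ⊂ `L`-blocks), fields `X d → E`,
`[NormedAddCommGroup E] [NormedSpace ℝ E]` (`E = ℂ` the printed case; `E = ℝ` the tree's).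
* Part 1 — `E`-VALUED BLOCK AVERAGES AND DERIVATIVES: `qavgV`, `fdFineV`, `fdUnitV` with `qavgV_real`∕`fdFineV_real`∕
  `fdUnitV_real` (`= SmallFieldBounds.qavg`∕`fdFine`∕`fdUnit` at `E = ℝ`), linearity, the two averaging facts
  `norm_qavgV_le` ((base1) step) and `norm_qavgV_sub_le` ((base2) step, via `sum_B_add_e_eq`, `sub_eq_sum_steps`), the
  lattice fact `blk_add_steps`∕`add_steps_mem_U`.
* Part 2 — THE PREDICATE `LocalFieldBounds` (the three bounds `‖Φ − Qφ‖ ≤ q` on `S₀`, `‖∂φ‖ ≤ q` on the fine bonds of `S`,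
  `‖φ‖ ≤ qα⁻¹` on the fine sites of `S`) with **`localFieldBounds_real_iff`** (`E = ℝ`: `↔ LocalSmallField`, every `q, α`),
  `qavgV_ofReal`, `fdFineV_ofReal`, **`localFieldBounds_ofReal_iff`** (a real pair read in `ℂ`), and the algebra of the
  scaled classes over `E`: `mono`, `congr_unit`, `lfb_add`, `lfb_mono`, `lfb_mono₂`, `lfb_smul` (real multiples),
  `lfb_of_fine_sup`, **`lfb_fine_replacement`**, **`lfb_unit_perturbation`** (the two replacement mechanisms of the proof).
* Part 3 — (scone3) AND THE INCLUSION: `norm_unit_le` (`‖Φ‖ ≤ q + qα⁻¹`), `norm_fdUnitV_le` (`‖∂Φ‖ ≤ 3q`), **`scone3`** (at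
  `α = 1`: `‖Φ‖ ≤ 2q`, `‖∂Φ‖ ≤ 3q` — *"As in lemma threeone …"* PROVED for the `E`-valued predicate, hence for the complex
  domain), **`pDomain_of_localSmallField`** (*"𝒮_k(□) ⊂ 𝒫_k(□, δ)"*: a real pair in the class `(p_k, α_k)` lies, complexified,
  in the class `(q, 1)` once `p_k ≤ q`, `p_kα_k⁻¹ ≤ q`), `inclusion_arith` + `inv_alpha_le_rpow` (`α_k⁻¹ ≤ λ_k^{−1/4}` for
  `ConstantFieldSplit.alpha`) + **`log_pow_le_rpow_neg`** (*"λ_k sufficiently small"* for `p_k = (−log λ_k)^p ≤ λ_k^{−δ}` MADE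
  EXPLICIT: `−log λ_k ≥ 4p²∕δ²`) ⟹ **`pDomain_of_localSmallField_explicit`** (the inclusion with the tree's `p_k`, `α_k`).
* Part 4 — THE PRINTED DOMAINS AS INSTANCES: **`PDomain n c lam δ`** (= `c𝒫_k(□, δ)`: bound `cλ_k^{−(1/4+δ)}`, `α = 1`),
  **`PDomain0 n c lam L δ`** (= `c𝒫⁰_{k+1}(□, δ)` on the `L`-block carrier: bound `cλ_{k+1}^{−(1/4+δ)}L^{−1/2}`), **`PDomainX`**
  (`𝒫_k(X, δ) = ∩_{□⊂X}𝒫_k(□, δ)` as a conjunction over an index set of cubes, each with its `S₀ □`, `S □` and its own fine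
  field `φ_{k,Ω(□)}`), `pDomainX_mono` (*"𝒫_k(Ω^♮_k, 2δ) is contained in 𝒫_k(Λ_k, 2δ)"*), `scone3_pDomain`, **`somewhat`**.
* Part 5 — LEMMA 3.14: case (A) **`lamp2`** ((lamp1) + (note9) with *"M large"* = `ε ≤ q` ⟹ (lamp2), class `2q`), **`psiOfV`**
  (= (ding3) over `E`; `psiOfV_real : psiOfV = RedundantCharacteristicFunctions.psiOf`), `fdFineV_two_level`, **`lamp3`**
  ((lamp2) on the `L`-blocks ⟹ (lamp3) for `(Ψ, φ)` on their unit points, `0 ≤ c ≤ 1`), **`lamp4`** ((note8) with `ε ≤ q`: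
  class `3q`), **`lamp4_loc`** (`Ψ̂ ↦ Ψ̂^{loc}` under an additive background map: class `4q` when `(1+K)t ≤ q`),
  **`caseA_arith`** (*"for L large, 4λ_{k+1}^{−1/4−2δ}L^{−1/2} = 4λ_k^{−1/4−2δ}L^{−3/4−2δ} ≤ ½λ_k^{−1/4−2δ}"* with `λ_{k+1} = Lλ_k`
  and *"L large"* = `8 ≤ L^{3/4+2δ}`; `caseA_condition_sixteen`: `L = 16` works for every `δ ≥ 0`), **`caseA`**, and the
  whole case in one stroke **`caseA_chain`** (from `PDomain0 … (2δ)` + (note9) + (note8) + the `loc` step to `PDomain n′ ½ λ_k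
  (2δ)`); cases (B)∕(C) **`caseB_arith`** (*"for λ_k sufficiently small Cλ_{k+1}^{−1/4−δ} ≤ ½λ_k^{−1/4−2δ}"* with *"sufficiently
  small"* = `2Cλ_k^δ ≤ 1`, `L ≥ 1`, `δ ≥ 0`), **`caseB`** ((lamp5)-class ⟹ `½𝒫_k(□, 2δ)`), **`caseB_chain`** ((substandard) sup
  bound + LEMMA 3.1 (2)'s mechanism as the hypothesis shape `converse` ⟹ `½𝒫_k(□, 2δ)`, the derivative bound on `Ψ`
  supplied by `norm_fdUnitV_le_two_mul`), **`caseC`** (class `Cλ_k^{−1/4−δ}` ⟹ `½𝒫_k(□, 2δ)`); the assembly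
  **`lemma314_technical`** (cubes of `Ω^♮_k` covered by the three regions, glued unit field `F` = `Φ_k` off `Ω_{k+1}`,
  `Ψ^{loc}` on `Ω_{k+1}`; per-case classes ⟹ `PDomainX cubes n′ ½ λ_k (2δ) S₀ S F φ^{min}` = *"∈ ½𝒫_k(Ω^♮_k, 2δ)"*).
* Part 6 (v1.1) — LEMMA 3.9 (2) FROM (1), over `E` (so that the `E = ℂ` instance is (substandard) of LEMMA 3.14 (B)):
  **`norm_psiOfV_le`** ((ding) ⟹ (swish) for the field: `‖φ⁰‖ ≤ A` on the fine sites, `‖Φ_{k+1} − Q_{k+1}φ⁰‖ ≤ D` on the `L`-blocks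
  ⟹ `‖Ψ‖ ≤ A + cD` on their unit points), **`norm_fdUnitV_psiOfV_le`** (the derivative: `‖∂φ⁰‖ ≤ B` ⟹ `‖∂Ψ‖ ≤ B + 2cD` —
  *"since it is defined on a unit lattice"*), **`norm_psiOfV_sub_psiOfV_le`** ((skunky2) ⟹ (tiny0): two `Ψ`'s with fine fields
  `t`-close differ by `≤ (1 + c)t`), **`salt_of_tiny0`** ((tiny0) cube by cube ⟹ (salt) for the glued `Ψ^{loc}`),
  **`norm_fdUnitV_glued_le`** (the boundary-crossing derivative `≤ B′ + s`).
* Part 7 (v1.2) — THE FINE-FIELD DOMAIN `ℛ_k`: **`RDomain n c lam ε αH S φ`** (= `cℛ_k(X, ε)` over `E`: `‖φ‖ < cλ^{−(1/4+3ε)}` on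
  the fine sites, `‖∂φ‖ < cλ^{−(1/4+2ε)}` on the fine bonds, and the Hölder clause `‖∂_μφ(x) − ∂_μφ(x′)‖ < cλ^{−(1/4+ε)}·(dist x
  x′∕(n+1))^α` for fine sites `x ≠ x′` at sup-distance `≤ n+1` — `ℛ_k` was typed nowhere in the lineage, cf. `SmallFieldBounds`'
  NOT CLAIMED *"I LEMMA `strong` (2.) (φ_k ∈ ℛ_k)"*), `rpow_thresholds_mono` (the three thresholds ordered for `λ ≤ 1`),
  **`lemmaStrong_two`** (part I LEMMA `strong` (2) ASSEMBLED: (gk2) as the hypothesis shape `‖φ_k‖, ‖∂φ_k‖ ≤ C·B`, `‖δ_α∂φ_k‖ ≤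
  C·B·d^α` with `B ≤ 2p_kλ_k^{−1/4}` (part (1), the tree's `lemmaStrong_abs`) and `2Cp_k < λ_k^{−ε}` ⟹ `φ_k ∈ ℛ_k`),
  **`log_pow_le_factorial_rpow`** (the PRINTED `(−log λ)^p ≤ p!(2∕ε)^p λ^{−ε∕2}`, from Mathlib's `Real.pow_div_factorial_le_exp`),
  **`log_pow_le_rpow_neg_printed`** (`… ≤ λ^{−ε}` once `p!(2∕ε)^p ≤ λ^{−ε∕2}`), **`half_rDomain_of_bounds`** ((dos)-type bounds
  `Cλ^{−(1/4+2δ)}` on field, derivative and Hölder quotient ⟹ `½ℛ_k(X, ε)` under `2Cλ^{ε−2δ} < 1` — *"since 2δ < ε"*),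
  `rDomain_mono`, `rDomain_add` (the step `φ ∈ ½ℛ_k, t𝒲 ∈ ½ℛ_k ⟹ φ + t𝒲 ∈ ℛ_k` of LEMMA 3.15's proof (A)).
* Part 8 (v1.3) — **`rDomain_of_uniform_bound`** (uniform bounds `B` on field, derivative, Hölder quotient with `B < cλ^{−(1/4+ε)}`
  ⟹ `cℛ_k`), **`calW_mem_rDomain`** (part I LEMMA 16 (`\label{11}`), last clause *"Furthermore 𝒲_k ∈ λ_k^{1/4}ℛ_k"* ASSEMBLED from
  (wbounds) with `Cp_{0,k} < λ_k^{−ε}` — the row «D1 §4.3» item recorded as NOT reproduced at `CovarianceSquareRoot` v1.1); THE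
  ANALYTICITY DISC (complex-valued fields, `E = ℂ`): `fdFineV_const_mul`, **`rDomain_const_mul_of_bounds`**
  (uniform bounds `K` on `𝒲`, `∂𝒲`, `δ_α∂𝒲` and `|t| ≤ T` with `T·K < c′λ^{−(1/4+ε)}` ⟹ `t𝒲 ∈ c′ℛ_k`), **`tW_mem_half_rDomain`**
  (*"if |t| ≤ λ_k^{−1/4} we have |t𝒲_{k,Ω′}| ≤ CB_wp_kλ_k^{−1/4} ≤ ½λ_k^{−1/4−3ε} … so t𝒲_{k,Ω′} ∈ ½ℛ_k"* with `K = CB_wp_k` and *"λ_k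
  sufficiently small"* = `2K < λ_k^{−ε}`), **`disc_subset_rDomain`** (`φ ∈ ½ℛ_k` ⟹ `φ + t𝒲 ∈ ℛ_k` for EVERY `|t| ≤ λ_k^{−1/4}`: the
  field stays in the analyticity domain on the whole closed disc — the hypothesis of the Cauchy bound that follows in the
  print, cf. `InterpolationRemoval.sub_eq_contour_kernel`, `PolydiscCauchyBounds`).
* Non-vacuity: `zero_mem`, and an `example` of a genuinely complex (purely imaginary) configuration in `𝒫_k(□, δ)`.

**Readings ∕ divergences (declared).**  (i) As in `RedundantCharacteristicFunctions` reading (i): the fine derivative of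
the predicate is in units of the block side, so (startrek)'s `|∂φ| ≤ λ_{k+1}^{−1/4−δ}L^{−3/2}` (in `L^{−k}`-units) is carried as
`‖fdFineV n φ‖ ≤ λ_{k+1}^{−1/4−δ}L^{−1/2}` with `n + 1 = L^{k+1}` — `PDomain0` has all three bounds equal, exactly as (not) was
read there; (lamp3)∕(lamp4)'s second clauses (sharper by `L^{−1}` in unit units, `fdFineV_two_level`) are carried in the
weaker form `≤ 2q`, `≤ 3q`, which is all the conclusion uses.  (ii) The analytic inputs are hypotheses with the printed
shapes: (note9)∕(note8) (`hδ`, `hdδ`: sup bounds `ε` on the difference of the two fine fields and of their derivatives,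
*"for M large"* = `ε ≤ q₁ = λ_{k+1}^{−1/4−2δ}L^{−1/2}`), the `Ψ̂ ↦ Ψ̂^{loc}` sentence L4285 (`‖Ψ^{loc} − Ψ‖ ≤ t` with an ADDITIVE
background map `bg = Ψ ↦ φ^{min}_{k,Ω(□)}(Ψ)` and `‖bg δ‖, ‖∂bg δ‖ ≤ Kt`, `(1+K)t ≤ q₁` — the regularity used tacitly, as
in LEMMA 3.13), (substandard) (`hsup`), LEMMA 3.1 (2)'s mechanism (`converse`, homogeneous in the sup bound; the unit
derivative bound it wants is supplied from the sup bound by the triangle inequality, `norm_fdUnitV_le_two_mul`), and the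
identity *"φ⁰_{k+1,Ω′} = φ_{k,Ω(Λ*_k)}(Ψ̂_{k,Ω′}) which still holds with complex fields"* (it enters only as the NAME of the fine
field in `lamp3`, which keeps the same function).  (iii) `λ_{k+1} = Lλ_k` (part I (recursive)); `δ ≥ 0`; the constants:
*"L large"* = `8 ≤ L^{3/4+2δ}`, *"λ_k sufficiently small"* = `2Cλ_k^δ ≤ 1` (cases (B), (C)) and `−log λ_k ≥ 4p²∕δ²` (the
inclusion) — explicit sufficient conditions, not claimed optimal.  (iv) `𝒫_k(X, δ)` for a union of cubes is the
conjunction `PDomainX` over an abstract index set of cubes with per-cube data (`S₀ □` = unit points of `□̃ ∩ Ω_k`, `S □` =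
cubes of `□̃`, `φ □` = `φ_{k,Ω(□)}`); the buffers `∼`, `♮`, `2♮`, `*` and the regions are not instantiated — the case split is
the hypothesis `hcover`.  (v) LOCATED, records only (not adjudicated): case (C)'s displayed target (lamp6) L4315–4319 has
`½λ_{k+1}^{−1/4−2δ}` on the right where the lemma's conclusion `½𝒫_k(□, 2δ)` (L4196–4197, L4226–4227) asks `½λ_k^{−1/4−2δ}`;
since `λ_{k+1}^{−1/4−2δ} = (Lλ_k)^{−1/4−2δ} ≤ λ_k^{−1/4−2δ}` the display is the stronger statement; `caseC` proves what the
conclusion asks, from the class `Cλ_k^{−1/4−δ}` that (somewhat)'s first line and *"Argue as in the previous case"* give.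
(vi) The pair structure `(Φ_{k−1,δΩ_{k−1}}, Φ_{k,Ω_k})` of (lamp) and the triple of `𝒫′_k` are carried, as in
`SmallFieldBounds`, by the single unit field of the predicate (the earlier fields enter `φ_{k,Ω(□)}` only, which is an
input here); `𝒫′_k` (with `φ′_{k,Ω(□)}` of (sunscreen)) is the same predicate with another fine field and is not given a
separate name; the scaled intersections `𝒫_{k,Ω}` (L2287–2291) and `𝒫⁰_{k+1,Ω⁺}` (L4211–4215, *"which scales to
𝒫_{k+1,Ω′}"*) are not typed (scaling of fields between lattices is not in this module).  (vii) Part 6: the print's constants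
`C` are kept symbolic (`A`, `B`, `D`) and (tiny0)'s right side is `(1 + c)·t` where the print writes `e^{−r_{k+1}}` (the factor `1
+ c ≤ 2` is absorbed there by (skunky2)'s room — located, not adjudicated); `Ψ(Ω′, s)`, `Ψ(Ω′, □*)` are the same `psiOfV` with
other fine fields (the statement *"The same holds for …"*), `Ψ^{loc}` is any field agreeing cube by cube with the `Ψ(Ω′, □*)`.
(viii) Part 7: the Hölder quotient's distance is the sup distance of `ℤ^d` (Mathlib's `dist` on `Fin d → ℤ`) in units of the
block side, *"d(x,x′) ≤ 1"* = `dist x x′ ≤ n + 1`, the quotient written multiplicatively (no division by `d^α`); the strict `<` of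
(rk) is kept, so the smallness hypotheses of `lemmaStrong_two` ∕ `half_rDomain_of_bounds` are strict; (gk2) ∕ (dos) enter as
hypothesis shapes with one constant `C`; *"λ_k sufficiently small"* = `2Cp_k < λ_k^{−ε}` resp. `2Cλ_k^{ε−2δ} < 1`; the print's
`p` is a positive integer (here `p : ℕ` in the two printed-smallness theorems, real elsewhere).  (ix) Part 8 is stated for
`E = ℂ` (fields `X d → ℂ`, `t : ℂ`, `t𝒲 = fun y ↦ t·𝒲 y`); the bounds on `𝒲_{k,Ω′}` (from (twoone1), (around), (somewhat)) are the
hypothesis shape `hsup`∕`hder`∕`hH` with one constant `K`.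

**What is NOT claimed.**  LEMMA 3.9 (1) ((not1), (skunky2): *"an argument very similar to lemma threetwo"*, the random-walk
exit estimate L3800–3811), part I (gk2) and part II (dos) (the kernel bounds on `G_k`, `∂G_k`, `δ_α∂G_k` — part I App. D), the
norms `‖E(X)‖_k = sup_{φ∈ℛ_k}`, the analyticity of `E_k(X, ·)` on `ℛ_k` and the Cauchy bounds drawn from it (LEMMA 3.15 (A)
L4512–4540), the bounds on `𝒲_{k,Ω′}`, (note9), (note8) (*"a variation of the argument leading to (note7)"*, *"a variation of (note6)"* —
random-walk estimates, LEMMA 3.12), (substandard) and the `e^{−r_{k+1}}` offset argument L4299–4301, (lamp1) from (sandy)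
(the `𝒫⁰_{k+1,Ω⁺}`∕scaling sentence), LEMMA 3.1 (2) itself (its kernel inputs are `ConstantFieldSplit` ∕
`MinimizerSupNormBound` on the matrix carrier; here the hypothesis shape `converse`), the construction of `Ψ^{loc}`,
`φ^{min}_{k,Ω(□)}`, `φ_{k,Ω(Λ*_k)}`, Remark 2 (*"The shrinkage … is tolerable since it is not repeated"*) beyond quotation, the
domains `ℛ_k` (L2305–2321), anything of B1–B16 (TEMPLATE.md §4.2 rows «D2 Def `\label{s}` …» and «D2 §3.10 new
characteristic functions» ↔ B7 Props 1–2 ∕ B8 §A ∕ B14 §3 — the rows' Bałaban side untouched, grades unchanged).  NOT summit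
progress; NOT a statement about any Bałaban paper; NOT continuum; NOT Clay.  NEW leaf; imports this lineage's
`RedundantCharacteristicFunctions` (⟶ `SmallFieldBounds`, `BlockAveragingComposition`, `ConstantFieldSplit`,
`CharacteristicFunctionSplit`); no Summits import; no cycle; modifies nothing; no named fact (net debt 0).  Unit
`b2b-balaban-template` gen 39 round 1 (journal CLAIM D2-ANALYTICITY-DOMAINS-KERNEL); cell records TEMPLATE.md §4.2 rows «D2
Def `\label{s}` S_k(□), Lemmas threeone, threetwo» and «D2 §3.10 new characteristic functions» (§3.11 items); GAPS C-tmpl39-1.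

**Version.**  v1 (gen 39 round 1, literature-prover-b2b-balaban-template-g39-0, 2026-08-20, p226924 commit a68af383ebd7);
v1.1 (gen 39 round 2, same seat): APPEND-ONLY Part 6 (LEMMA 3.9 (2) from (1)); every v1 declaration and proof byte-identical,
imports unchanged; header extended (title, citation header, quotations, Part 6 bullet, reading (vii)) — p227283 commit
4cfde1f17955; cell records TEMPLATE.md §4.2 row «D2 §3.10 new characteristic functions», GAPS C-tmpl39-2.  v1.2 (gen 39 round 3,
same seat): APPEND-ONLY Part 7 (`ℛ_k`, part I LEMMA `strong` (2), the printed smallness, `½ℛ_k`); every v1.1 declaration and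
proof byte-identical, imports unchanged; header extended (title, citation header with the part I loci, quotations, Part 7
bullet, reading (viii)).  Cell records TEMPLATE.md §4.1 row «D1 §3.1–3.3» and §4.2 row «D2 Def `\label{s}` …»; GAPS C-tmpl39-3.
v1.3 (gen 39 round 4, same seat): APPEND-ONLY Part 8 (uniform bounds ⟹ `cℛ_k`, part I LEMMA 16's «𝒲_k ∈ λ_k^{1/4}ℛ_k», complex
multiples in `ℛ_k`, the analyticity disc of LEMMA 3.15 (A)); every v1.2 declaration and proof byte-identical, imports unchanged;
header extended (title, citation header, Part 8 bullet, reading (ix)).  Cell records TEMPLATE.md §4.1 row «D1 §4.3» and §4.2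
row «D2 §3.13 localization Lemmas 3.15–3.17»; GAPS C-tmpl39-4.
-/

noncomputable section

open Finset
open Literature.MathematicalPhysics.QuantumFieldTheory.Balaban1983to89.B6QGQLower276
open Literature.MathematicalPhysics.QuantumFieldTheory.Balaban1983to89.B5Ineq167LowerZd (chart_add_e)
open Literature.MathematicalPhysics.QuantumFieldTheory.Dimock2011to13.SmallFieldBounds
open Literature.MathematicalPhysics.QuantumFieldTheory.Dimock2011to13.BlockAveragingComposition (blk_blk)
open Literature.MathematicalPhysics.QuantumFieldTheory.Dimock2011to13.RedundantCharacteristicFunctions (U_comp psiOf)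
open Literature.MathematicalPhysics.QuantumFieldTheory.Dimock2011to13.ConstantFieldSplit (alpha alpha_pos)

namespace Literature.MathematicalPhysics.QuantumFieldTheory.Dimock2011to13.AnalyticityDomains

variable {d : ℕ} {E : Type*} [NormedAddCommGroup E] [NormedSpace ℝ E]

/-! ## Part 1. Block averages and lattice derivatives of fields with values in a real normed space -/

/-- the block average of an `E`-valued fine field: `(Q f)(y) = (n+1)^{−d} Σ_{p ∈ B(y)} f(p)`.
[cite: Dimock2013BalabanII, §2.1 L462–469 (arXiv:1212.5562v2 TeX)] -/
def qavgV (n : ℕ) (f : X d → E) (y : X d) : E := ((((n : ℝ) + 1) ^ d)⁻¹ : ℝ) • ∑ p ∈ B n y, f p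

/-- the forward derivative on the fine lattice of spacing `(n+1)⁻¹`: `(n+1)(f(x + e_μ) − f(x))`.
[cite: Dimock2013BalabanII, §3.2 Definition (lamp) L2248–2253 (arXiv:1212.5562v2 TeX)] -/
def fdFineV (n : ℕ) (μ : Fin d) (f : X d → E) (x : X d) : E := (((n : ℝ) + 1) : ℝ) • (f (x + e μ) - f x)

/-- the forward derivative on the unit lattice: `F(y + e_μ) − F(y)`.
[cite: Dimock2013BalabanII, §3.2 eq. (scone3) L2264–2266 (arXiv:1212.5562v2 TeX)] -/
def fdUnitV (μ : Fin d) (F : X d → E) (y : X d) : E := F (y + e μ) - F y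

/-- at `E = ℝ` the block average is the tree's `SmallFieldBounds.qavg`.
[cite: Dimock2013BalabanII, §2.1 L462–469; §3.2 Definition 3.s (yass1) L2063–2073 (arXiv:1212.5562v2 TeX)] -/
theorem qavgV_real (n : ℕ) (f : X d → ℝ) (y : X d) : qavgV n f y = qavg n f y := by
  simp [qavgV, qavg_def, smul_eq_mul]

/-- at `E = ℝ` the fine derivative is the tree's `SmallFieldBounds.fdFine`.
[cite: Dimock2013BalabanII, §3.2 Definition 3.s (yass1) L2068–2069 (arXiv:1212.5562v2 TeX)] -/
theorem fdFineV_real (n : ℕ) (μ : Fin d) (f : X d → ℝ) (x : X d) : fdFineV n μ f x = fdFine n μ f x := by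
  simp [fdFineV, fdFine, smul_eq_mul]

/-- at `E = ℝ` the unit derivative is the tree's `SmallFieldBounds.fdUnit`.
[cite: Dimock2013BalabanII, §3.2 Lemma 3.1 proof (base2) L2131 (arXiv:1212.5562v2 TeX)] -/
theorem fdUnitV_real (μ : Fin d) (F : X d → ℝ) (y : X d) : fdUnitV μ F y = fdUnit μ F y := rfl

/-- sums over a block are sums over the coordinate cube (any additive commutative monoid).
[folklore] -/
private theorem sum_B_eq {M : Type*} [AddCommMonoid M] {n : ℕ} (y : X d) (f : X d → M) :
    ∑ p ∈ B n y, f p = ∑ z : Fin d → Fin (n + 1), f (chart n y z) :=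
  Finset.sum_image fun _ _ _ _ h => (chart_inj h).2

/-- a block has `(n+1)^d` sites.
[folklore] -/
private theorem card_B_real (n : ℕ) (y : X d) : ((B n y).card : ℝ) = ((n : ℝ) + 1) ^ d := by
  have h := sum_B_const (n := n) y (1 : ℝ)
  rw [Finset.sum_const, nsmul_eq_mul, mul_one, mul_one] at h
  exact h

/-- a sum over the block of `y + e_μ` is the sum over the block of `y` of the shifted summand.
[folklore] -/
private theorem sum_B_add_e_eq {M : Type*} [AddCommMonoid M] (n : ℕ) (y : X d) (μ : Fin d) (f : X d → M) :
    ∑ p ∈ B n (y + e μ), f p = ∑ p ∈ B n y, f (p + ((n + 1 : ℕ) : ℤ) • e μ) := by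
  rw [sum_B_eq, sum_B_eq]
  exact Finset.sum_congr rfl fun z _ => by rw [chart_add_e]

/-- `Q` is additive.
[cite: Dimock2013BalabanII, §3.11.3 Lemma 3.14 proof L4285–4289 (arXiv:1212.5562v2 TeX)] -/
theorem qavgV_add (n : ℕ) (f g : X d → E) (y : X d) : qavgV n (f + g) y = qavgV n f y + qavgV n g y := by
  simp only [qavgV, Pi.add_apply, Finset.sum_add_distrib, smul_add]

/-- `Q` respects differences.
[cite: Dimock2013BalabanII, §3.11.3 Lemma 3.14 proof L4250–4256 (arXiv:1212.5562v2 TeX)] -/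
theorem qavgV_sub (n : ℕ) (f g : X d → E) (y : X d) : qavgV n (f - g) y = qavgV n f y - qavgV n g y := by
  simp only [qavgV, Pi.sub_apply, Finset.sum_sub_distrib, smul_sub]

/-- `Q` is real-homogeneous.
[cite: Dimock2013BalabanII, §3.11.3 Lemma 3.14 L4196–4197 (arXiv:1212.5562v2 TeX)] -/
theorem qavgV_smul (n : ℕ) (c : ℝ) (f : X d → E) (y : X d) : qavgV n (c • f) y = c • qavgV n f y := by
  simp only [qavgV, Pi.smul_apply, ← Finset.smul_sum, smul_comm c]

/-- `∂` is additive.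
[cite: Dimock2013BalabanII, §3.11.3 Lemma 3.14 proof L4285–4289 (arXiv:1212.5562v2 TeX)] -/
theorem fdFineV_add (n : ℕ) (μ : Fin d) (f g : X d → E) (x : X d) :
    fdFineV n μ (f + g) x = fdFineV n μ f x + fdFineV n μ g x := by
  simp only [fdFineV, Pi.add_apply, ← smul_add]
  congr 1
  abel

/-- `∂` respects differences.
[cite: Dimock2013BalabanII, §3.11.3 Lemma 3.14 proof L4250–4256 (arXiv:1212.5562v2 TeX)] -/
theorem fdFineV_sub (n : ℕ) (μ : Fin d) (f g : X d → E) (x : X d) :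
    fdFineV n μ (f - g) x = fdFineV n μ f x - fdFineV n μ g x := by
  simp only [fdFineV, Pi.sub_apply, ← smul_sub]
  congr 1
  abel

/-- `∂` is real-homogeneous.
[cite: Dimock2013BalabanII, §3.11.3 Lemma 3.14 L4196–4197 (arXiv:1212.5562v2 TeX)] -/
theorem fdFineV_smul (n : ℕ) (μ : Fin d) (c : ℝ) (f : X d → E) (x : X d) :
    fdFineV n μ (c • f) x = c • fdFineV n μ f x := by
  simp only [fdFineV, Pi.smul_apply, ← smul_sub, smul_comm c]

/-- AVERAGING FACT 1: `‖(Qf)(y)‖ ≤ M` when `‖f‖ ≤ M` on the block `B(y)`.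
[cite: Dimock2013BalabanII, §3.2 Lemma 3.1 proof (base1) L2123–2127 (arXiv:1212.5562v2 TeX)] -/
theorem norm_qavgV_le {n : ℕ} {f : X d → E} {y : X d} {M : ℝ} (h : ∀ p ∈ B n y, ‖f p‖ ≤ M) :
    ‖qavgV n f y‖ ≤ M := by
  have hc : (0 : ℝ) < ((n : ℝ) + 1) ^ d := by positivity
  rw [qavgV, norm_smul, norm_inv, Real.norm_of_nonneg hc.le, inv_mul_le_iff₀ hc]
  calc ‖∑ p ∈ B n y, f p‖ ≤ ∑ p ∈ B n y, ‖f p‖ := norm_sum_le _ _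
    _ ≤ ∑ _p ∈ B n y, M := Finset.sum_le_sum h
    _ = ((n : ℝ) + 1) ^ d * M := by rw [Finset.sum_const, nsmul_eq_mul, card_B_real]

omit [NormedSpace ℝ E] in
/-- telescoping along `e_μ`: `f(p + m e_μ) − f(p) = Σ_{t<m} (f(p + te_μ + e_μ) − f(p + te_μ))`.
[folklore] -/
private theorem sub_eq_sum_steps (f : X d → E) (p : X d) (μ : Fin d) (m : ℕ) :
    f (p + (m : ℤ) • e μ) - f p
      = ∑ t ∈ Finset.range m, (f (p + (t : ℤ) • e μ + e μ) - f (p + (t : ℤ) • e μ)) := by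
  induction m with
  | zero => simp
  | succ m ih =>
    rw [Finset.sum_range_succ, ← ih]
    have h1 : p + ((m + 1 : ℕ) : ℤ) • e μ = p + (m : ℤ) • e μ + e μ := by
      rw [Nat.cast_succ, add_smul, one_smul, add_assoc]
    rw [h1]
    abel

/-- AVERAGING FACT 2: `‖(Qf)(y + e_μ) − (Qf)(y)‖ ≤ (n+1)·D` when every single-step difference along the `n+1` translates
of `B(y)` towards `B(y + e_μ)` is `≤ D`.
[cite: Dimock2013BalabanII, §3.2 Lemma 3.1 proof (base2) L2128–2137 (arXiv:1212.5562v2 TeX)] -/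
theorem norm_qavgV_sub_le {n : ℕ} {f : X d → E} {y : X d} {μ : Fin d} {D : ℝ}
    (h : ∀ p ∈ B n y, ∀ t : ℕ, t < n + 1 →
      ‖f (p + (t : ℤ) • e μ + e μ) - f (p + (t : ℤ) • e μ)‖ ≤ D) :
    ‖qavgV n f (y + e μ) - qavgV n f y‖ ≤ ((n : ℝ) + 1) * D := by
  have hc : (0 : ℝ) < ((n : ℝ) + 1) ^ d := by positivity
  have e1 : qavgV n f (y + e μ) - qavgV n f y
      = ((((n : ℝ) + 1) ^ d)⁻¹ : ℝ) • ∑ p ∈ B n y, (f (p + ((n + 1 : ℕ) : ℤ) • e μ) - f p) := by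
    rw [qavgV, qavgV, sum_B_add_e_eq, ← smul_sub, Finset.sum_sub_distrib]
  rw [e1, norm_smul, norm_inv, Real.norm_of_nonneg hc.le, inv_mul_le_iff₀ hc]
  calc ‖∑ p ∈ B n y, (f (p + ((n + 1 : ℕ) : ℤ) • e μ) - f p)‖
      ≤ ∑ p ∈ B n y, ‖f (p + ((n + 1 : ℕ) : ℤ) • e μ) - f p‖ := norm_sum_le _ _
    _ ≤ ∑ _p ∈ B n y, ((n : ℝ) + 1) * D := by
        refine Finset.sum_le_sum fun p hp => ?_
        rw [sub_eq_sum_steps]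
        calc ‖∑ t ∈ Finset.range (n + 1), (f (p + (t : ℤ) • e μ + e μ) - f (p + (t : ℤ) • e μ))‖
            ≤ ∑ t ∈ Finset.range (n + 1), ‖f (p + (t : ℤ) • e μ + e μ) - f (p + (t : ℤ) • e μ)‖ :=
              norm_sum_le _ _
          _ ≤ ∑ _t ∈ Finset.range (n + 1), D :=
              Finset.sum_le_sum fun t ht => h p hp t (Finset.mem_range.1 ht)
          _ = ((n : ℝ) + 1) * D := by
              rw [Finset.sum_const, Finset.card_range, nsmul_eq_mul]; push_cast; ring
    _ = ((n : ℝ) + 1) ^ d * (((n : ℝ) + 1) * D) := by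
        rw [Finset.sum_const, nsmul_eq_mul, card_B_real]

/-- LATTICE FACT: a site of the block `B(y)` moved `t ≤ n + 1` steps in direction `μ` has block label `y` or `y + e_μ`.
[folklore] -/
private theorem blk_add_steps {n : ℕ} (p : X d) (μ : Fin d) {t : ℕ} (ht : t ≤ n + 1) :
    blk n (p + (t : ℤ) • e μ) = blk n p ∨ blk n (p + (t : ℤ) • e μ) = blk n p + e μ := by
  have hs : (0 : ℤ) < side n := (side_facts n).1
  have hsd : side n = (n : ℤ) + 1 := rfl
  have hdec := side_mul_blk_add_loc n p μ
  have hl0 := loc_nonneg n p μ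
  have hl1 := loc_lt n p μ
  have hμ : (p + (t : ℤ) • e μ) μ = p μ + t := by simp [Pi.add_apply]
  have hother : ∀ ν, ν ≠ μ → blk n (p + (t : ℤ) • e μ) ν = blk n p ν := by
    intro ν hν
    show (p + (t : ℤ) • e μ) ν / side n = p ν / side n
    simp [Pi.add_apply, e_apply_ne hν]
  by_cases hlt : loc n p μ + t < side n
  · left
    funext ν
    by_cases hν : ν = μ
    · subst hν
      show (p + (t : ℤ) • e ν) ν / side n = blk n p ν
      rw [hμ, show p ν + (t : ℤ) = (loc n p ν + t) + side n * blk n p ν by linarith,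
        Int.add_mul_ediv_left _ _ hs.ne', Int.ediv_eq_zero_of_lt (by omega) hlt, zero_add]
    · exact hother ν hν
  · right
    funext ν
    by_cases hν : ν = μ
    · subst hν
      show (p + (t : ℤ) • e ν) ν / side n = (blk n p + e ν) ν
      rw [hμ, show p ν + (t : ℤ) = (loc n p ν + t - side n) + side n * (blk n p ν + 1) by linarith,
        Int.add_mul_ediv_left _ _ hs.ne', Int.ediv_eq_zero_of_lt (by omega) (by omega), zero_add]
      simp [Pi.add_apply]
    · rw [hother ν hν]
      simp [Pi.add_apply, e_apply_ne hν]

/-- consequence: if the blocks `y = blk p` and `y + e_μ` both belong to `S`, every site of `B(y)` moved `t ≤ n + 1` steps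
in direction `μ` is a fine site of `S`.
[folklore] -/
private theorem add_steps_mem_U {n : ℕ} {S : Finset (X d)} {p : X d} {μ : Fin d} (hp : blk n p ∈ S)
    (hpe : blk n p + e μ ∈ S) {t : ℕ} (ht : t ≤ n + 1) : p + (t : ℤ) • e μ ∈ U n S := by
  rw [mem_U]
  rcases blk_add_steps p μ ht with h | h
  · rw [h]; exact hp
  · rw [h]; exact hpe

/-! ## Part 2. The common shape of DEFINITION 3.s (yass1) and of the analyticity domains (lamp), (startrek):
one predicate for fields with values in a real normed space `E` (`E = ℂ`: the printed complex domains) -/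

/-- **THE THREE LOCAL BOUNDS for an `E`-valued pair** (unit field `Φ`, fine field `φ`): `‖Φ − Qφ‖ ≤ q` on the unit
points `S₀`, `‖∂φ‖ ≤ q` on the fine bonds of `S`, `‖φ‖ ≤ qα⁻¹` on the fine sites of `S`.  At `E = ℝ` this IS the tree's
`SmallFieldBounds.LocalSmallField` (DEFINITION 3.s, `localFieldBounds_real_iff`); at `E = ℂ`, `α = 1`, `q = λ_k^{−1/4−δ}` it
is DEFINITION (lamp) `𝒫_k(□, δ)`, and with `q = λ_{k+1}^{−1/4−δ}L^{−1/2}` on the `L`-block carrier it is `𝒫⁰_{k+1}(□, δ)`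
(startrek).
[cite: Dimock2013BalabanII, §3.2 Definition 3.s (yass1) L2063–2073 and Definition (lamp) L2245–2258, §3.11.3 (startrek) L4168–4179 (arXiv:1212.5562v2 TeX)] -/
def LocalFieldBounds (n : ℕ) (q α : ℝ) (S₀ S : Finset (X d)) (Φ φ : X d → E) : Prop :=
  (∀ y ∈ S₀, ‖Φ y - qavgV n φ y‖ ≤ q) ∧
    (∀ μ : Fin d, ∀ x ∈ U n S, x + e μ ∈ U n S → ‖fdFineV n μ φ x‖ ≤ q) ∧
      (∀ x ∈ U n S, ‖φ x‖ ≤ q * α⁻¹)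

/-- unfolding.
[cite: Dimock2013BalabanII, §3.2 Definition (lamp) L2245–2258 (arXiv:1212.5562v2 TeX)] -/
theorem localFieldBounds_iff (n : ℕ) (q α : ℝ) (S₀ S : Finset (X d)) (Φ φ : X d → E) :
    LocalFieldBounds n q α S₀ S Φ φ ↔
      (∀ y ∈ S₀, ‖Φ y - qavgV n φ y‖ ≤ q) ∧
        (∀ μ : Fin d, ∀ x ∈ U n S, x + e μ ∈ U n S → ‖fdFineV n μ φ x‖ ≤ q) ∧
          (∀ x ∈ U n S, ‖φ x‖ ≤ q * α⁻¹) := Iff.rfl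

/-- **AT `E = ℝ` THE PREDICATE IS THE TREE's DEFINITION 3.s** (`SmallFieldBounds.LocalSmallField`), for every `q, α`.
[cite: Dimock2013BalabanII, §3.2 Definition 3.s (yass1) L2063–2073 (arXiv:1212.5562v2 TeX)] -/
theorem localFieldBounds_real_iff {n : ℕ} {q α : ℝ} {S₀ S : Finset (X d)} {Φ φ : X d → ℝ} :
    LocalFieldBounds n q α S₀ S Φ φ ↔ LocalSmallField n q α S₀ S Φ φ := by
  simp only [LocalFieldBounds, localSmallField_iff, Real.norm_eq_abs, qavgV_real, fdFineV_real]

/-- the block average commutes with the inclusion `ℝ ⊂ ℂ`.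
[cite: Dimock2013BalabanII, §3.2 L2267 (arXiv:1212.5562v2 TeX)] -/
theorem qavgV_ofReal (n : ℕ) (φ : X d → ℝ) (y : X d) :
    qavgV n (fun x => (φ x : ℂ)) y = ((qavgV n φ y : ℝ) : ℂ) := by
  simp only [qavgV, smul_eq_mul, Complex.ofReal_mul, Complex.ofReal_sum, Complex.real_smul]

/-- the fine derivative commutes with the inclusion `ℝ ⊂ ℂ`.
[cite: Dimock2013BalabanII, §3.2 L2267 (arXiv:1212.5562v2 TeX)] -/
theorem fdFineV_ofReal (n : ℕ) (μ : Fin d) (φ : X d → ℝ) (x : X d) :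
    fdFineV n μ (fun x => (φ x : ℂ)) x = ((fdFineV n μ φ x : ℝ) : ℂ) := by
  simp only [fdFineV, smul_eq_mul, Complex.ofReal_mul, Complex.ofReal_sub, Complex.real_smul]

/-- **REAL FIELDS VIEWED AS COMPLEX FIELDS**: the bounds for `(Φ, φ)` read in `ℂ` are the bounds read in `ℝ`
(the sense of *"Note also that 𝒮_k(□) ⊂ 𝒫_k(□, δ)"*: real configurations inside the complex domain).
[cite: Dimock2013BalabanII, §3.2 L2267 (arXiv:1212.5562v2 TeX)] -/
theorem localFieldBounds_ofReal_iff {n : ℕ} {q α : ℝ} {S₀ S : Finset (X d)} {Φ φ : X d → ℝ} :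
    LocalFieldBounds n q α S₀ S (fun x => (Φ x : ℂ)) (fun x => (φ x : ℂ)) ↔ LocalFieldBounds n q α S₀ S Φ φ := by
  simp only [LocalFieldBounds, qavgV_ofReal, fdFineV_ofReal, ← Complex.ofReal_sub, Complex.norm_real]

section Classes

variable {n : ℕ} {q q₁ q₂ q' α α' : ℝ} {S₀ S S₀' S' : Finset (X d)} {Φ Φ₁ Φ₂ φ φ₁ φ₂ : X d → E}

/-- monotonicity in the two index sets ((yass2) ∕ `𝒫_k(X, δ) = ∩_{□⊂X}𝒫_k(□, δ)`, L2255–2257, for the predicate).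
[cite: Dimock2013BalabanII, §3.2 Definition (lamp) L2255–2257 (arXiv:1212.5562v2 TeX)] -/
theorem LocalFieldBounds.mono (h : LocalFieldBounds n q α S₀ S Φ φ) (h₀ : S₀' ⊆ S₀) (h₁ : S' ⊆ S) :
    LocalFieldBounds n q α S₀' S' Φ φ := by
  have hU : U n S' ⊆ U n S := fun x hx => mem_U.2 (h₁ (mem_U.1 hx))
  exact ⟨fun y hy => h.1 y (h₀ hy), fun μ x hx hxe => h.2.1 μ x (hU hx) (hU hxe), fun x hx => h.2.2 x (hU hx)⟩

/-- the predicate sees the unit field only through its values on `S₀`.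
[cite: Dimock2013BalabanII, §3.11.3 Lemma 3.14 proof L4226–4227 (arXiv:1212.5562v2 TeX)] -/
theorem LocalFieldBounds.congr_unit {Φ' : X d → E} (h : LocalFieldBounds n q α S₀ S Φ φ)
    (hΦ : ∀ y ∈ S₀, Φ' y = Φ y) : LocalFieldBounds n q α S₀ S Φ' φ :=
  ⟨fun y hy => by rw [hΦ y hy]; exact h.1 y hy, h.2.1, h.2.2⟩

/-- the classes add: `c₁𝒫 + c₂𝒫 ⊆ (c₁ + c₂)𝒫` (all three bounds are seminorm bounds).
[cite: Dimock2013BalabanII, §3.11.3 Lemma 3.14 proof L4285–4289 (arXiv:1212.5562v2 TeX)] -/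
theorem lfb_add (h₁ : LocalFieldBounds n q₁ α S₀ S Φ₁ φ₁) (h₂ : LocalFieldBounds n q₂ α S₀ S Φ₂ φ₂) :
    LocalFieldBounds n (q₁ + q₂) α S₀ S (Φ₁ + Φ₂) (φ₁ + φ₂) := by
  refine ⟨fun y hy => ?_, fun μ x hx hxe => ?_, fun x hx => ?_⟩
  · have e1 : (Φ₁ + Φ₂) y - qavgV n (φ₁ + φ₂) y = (Φ₁ y - qavgV n φ₁ y) + (Φ₂ y - qavgV n φ₂ y) := by
      rw [Pi.add_apply, qavgV_add]; abel
    rw [e1]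
    exact (norm_add_le _ _).trans (add_le_add (h₁.1 y hy) (h₂.1 y hy))
  · rw [fdFineV_add]
    exact (norm_add_le _ _).trans (add_le_add (h₁.2.1 μ x hx hxe) (h₂.2.1 μ x hx hxe))
  · rw [Pi.add_apply, add_mul]
    exact (norm_add_le _ _).trans (add_le_add (h₁.2.2 x hx) (h₂.2.2 x hx))

/-- `c𝒫 ⊆ c′𝒫` for `c ≤ c′` (`α ≥ 0`).
[cite: Dimock2013BalabanII, §3.11.3 Lemma 3.14 proof L4288–4289 (arXiv:1212.5562v2 TeX)] -/
theorem lfb_mono (hα : 0 ≤ α) (h : LocalFieldBounds n q α S₀ S Φ φ) (hq : q ≤ q') :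
    LocalFieldBounds n q' α S₀ S Φ φ :=
  ⟨fun y hy => (h.1 y hy).trans hq, fun μ x hx hxe => (h.2.1 μ x hx hxe).trans hq,
    fun x hx => (h.2.2 x hx).trans (mul_le_mul_of_nonneg_right hq (inv_nonneg.2 hα))⟩

/-- change of the pair of parameters: `(q, α) ↦ (q′, α′)` with `q ≤ q′`, `qα⁻¹ ≤ q′α′⁻¹`.
[cite: Dimock2013BalabanII, §3.2 L2267 (arXiv:1212.5562v2 TeX)] -/
theorem lfb_mono₂ (h : LocalFieldBounds n q α S₀ S Φ φ) (hq : q ≤ q') (hqα : q * α⁻¹ ≤ q' * α'⁻¹) :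
    LocalFieldBounds n q' α' S₀ S Φ φ :=
  ⟨fun y hy => (h.1 y hy).trans hq, fun μ x hx hxe => (h.2.1 μ x hx hxe).trans hq,
    fun x hx => (h.2.2 x hx).trans hqα⟩

/-- real multiples: `c·(pair in the class q)` is in the class `|c|q`.
[cite: Dimock2013BalabanII, §3.11.3 Lemma 3.14 L4196–4197 (arXiv:1212.5562v2 TeX)] -/
theorem lfb_smul (h : LocalFieldBounds n q α S₀ S Φ φ) (c : ℝ) :
    LocalFieldBounds n (|c| * q) α S₀ S (c • Φ) (c • φ) := by
  refine ⟨fun y hy => ?_, fun μ x hx hxe => ?_, fun x hx => ?_⟩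
  · rw [Pi.smul_apply, qavgV_smul, ← smul_sub, norm_smul, Real.norm_eq_abs]
    exact mul_le_mul_of_nonneg_left (h.1 y hy) (abs_nonneg c)
  · rw [fdFineV_smul, norm_smul, Real.norm_eq_abs]
    exact mul_le_mul_of_nonneg_left (h.2.1 μ x hx hxe) (abs_nonneg c)
  · rw [Pi.smul_apply, norm_smul, Real.norm_eq_abs, mul_assoc]
    exact mul_le_mul_of_nonneg_left (h.2.2 x hx) (abs_nonneg c)

/-- a fine field `δ` with `‖δ‖ ≤ ε` on the fine sites of `S` and `‖∂δ‖ ≤ ε` on its fine bonds is, paired with the unit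
field `0`, in the class `ε` (`0 < α ≤ 1`).
[cite: Dimock2013BalabanII, §3.11.3 Lemma 3.14 proof L4250–4256 (arXiv:1212.5562v2 TeX)] -/
theorem lfb_of_fine_sup {ε : ℝ} {δ : X d → E} (hα : 0 < α) (hα1 : α ≤ 1) (hS : S₀ ⊆ S)
    (hδ : ∀ x ∈ U n S, ‖δ x‖ ≤ ε)
    (hdδ : ∀ μ : Fin d, ∀ x ∈ U n S, x + e μ ∈ U n S → ‖fdFineV n μ δ x‖ ≤ ε) :
    LocalFieldBounds n ε α S₀ S 0 δ := by
  refine ⟨fun y hy => ?_, hdδ, fun x hx => ?_⟩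
  · rw [Pi.zero_apply, zero_sub, norm_neg]
    exact norm_qavgV_le fun p hp => hδ p (mem_U.2 (by rw [mem_B.1 hp]; exact hS hy))
  · have h1 := hδ x hx
    have hε : 0 ≤ ε := (norm_nonneg _).trans h1
    have hinv : 1 ≤ α⁻¹ := one_le_inv_iff₀.2 ⟨hα, hα1⟩
    calc ‖δ x‖ ≤ ε * 1 := by rw [mul_one]; exact h1
      _ ≤ ε * α⁻¹ := mul_le_mul_of_nonneg_left hinv hε

/-- **REPLACEMENT OF THE FINE FIELD**: `(Φ, φ)` in the class `q` and `φ′ − φ` `ε`-small with its derivative on the fine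
sites ∕ bonds of `S` ⟹ `(Φ, φ′)` in the class `q + ε` — the mechanism of *"Given (note9), then for M large we can
replace φ⁰_{k+1,Ω⁺(□)} by φ⁰_{k+1,Ω′} in (lamp1)"* and of the (note8) step.
[cite: Dimock2013BalabanII, §3.11.3 Lemma 3.14 proof L4250–4256, L4278–4284 (arXiv:1212.5562v2 TeX)] -/
theorem lfb_fine_replacement {ε : ℝ} {φ' : X d → E} (hα : 0 < α) (hα1 : α ≤ 1) (hS : S₀ ⊆ S)
    (h : LocalFieldBounds n q α S₀ S Φ φ) (hδ : ∀ x ∈ U n S, ‖(φ' - φ) x‖ ≤ ε)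
    (hdδ : ∀ μ : Fin d, ∀ x ∈ U n S, x + e μ ∈ U n S → ‖fdFineV n μ (φ' - φ) x‖ ≤ ε) :
    LocalFieldBounds n (q + ε) α S₀ S Φ φ' := by
  have h2 := lfb_add h (lfb_of_fine_sup hα hα1 hS hδ hdδ)
  have e1 : Φ + 0 = Φ := add_zero Φ
  have e2 : φ + (φ' - φ) = φ' := by abel
  rwa [e1, e2] at h2

/-- **PERTURBATION OF THE UNIT FIELD UNDER AN ADDITIVE BACKGROUND MAP**: `(Ψ, bg Ψ)` in the class `q`, `‖Ψ′ − Ψ‖ ≤ t`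
on `S₀`, `bg Ψ′ = bg Ψ + bg(Ψ′ − Ψ)` and `‖bg(Ψ′ − Ψ)‖, ‖∂ bg(Ψ′ − Ψ)‖ ≤ Kt` on the fine sites ∕ bonds of `S` ⟹
`(Ψ′, bg Ψ′)` in the class `q + (1 + K)t` — the mechanism of *"The same holds with Ψ̂_{k,Ω′} replaced by Ψ̂^{loc}_{k,Ω′}"*.
[cite: Dimock2013BalabanII, §3.11.3 Lemma 3.14 proof L4285–4286 (arXiv:1212.5562v2 TeX)] -/
theorem lfb_unit_perturbation {t K : ℝ} {bg : (X d → E) → X d → E} {Ψ Ψ' : X d → E} (hα : 0 < α) (hα1 : α ≤ 1)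
    (hS : S₀ ⊆ S) (hK : 0 ≤ K) (ht : 0 ≤ t) (h : LocalFieldBounds n q α S₀ S Ψ (bg Ψ))
    (hadd : bg Ψ' = bg Ψ + bg (Ψ' - Ψ)) (hδ : ∀ y ∈ S₀, ‖(Ψ' - Ψ) y‖ ≤ t)
    (hbg : ∀ x ∈ U n S, ‖bg (Ψ' - Ψ) x‖ ≤ K * t)
    (hdbg : ∀ μ : Fin d, ∀ x ∈ U n S, x + e μ ∈ U n S → ‖fdFineV n μ (bg (Ψ' - Ψ)) x‖ ≤ K * t) :
    LocalFieldBounds n (q + (1 + K) * t) α S₀ S Ψ' (bg Ψ') := by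
  have hinv : 1 ≤ α⁻¹ := one_le_inv_iff₀.2 ⟨hα, hα1⟩
  have hKt : K * t ≤ (1 + K) * t := by nlinarith
  have h1Kt : 0 ≤ (1 + K) * t := mul_nonneg (by linarith) ht
  have hpert : LocalFieldBounds n ((1 + K) * t) α S₀ S (Ψ' - Ψ) (bg (Ψ' - Ψ)) := by
    refine ⟨fun y hy => ?_, fun μ x hx hxe => (hdbg μ x hx hxe).trans hKt, fun x hx => ?_⟩
    · have h2 : ‖qavgV n (bg (Ψ' - Ψ)) y‖ ≤ K * t :=
        norm_qavgV_le fun p hp => hbg p (mem_U.2 (by rw [mem_B.1 hp]; exact hS hy))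
      calc ‖(Ψ' - Ψ) y - qavgV n (bg (Ψ' - Ψ)) y‖ ≤ ‖(Ψ' - Ψ) y‖ + ‖qavgV n (bg (Ψ' - Ψ)) y‖ := norm_sub_le _ _
        _ ≤ t + K * t := add_le_add (hδ y hy) h2
        _ = (1 + K) * t := by ring
    · calc ‖bg (Ψ' - Ψ) x‖ ≤ (1 + K) * t := (hbg x hx).trans hKt
        _ = (1 + K) * t * 1 := (mul_one _).symm
        _ ≤ (1 + K) * t * α⁻¹ := mul_le_mul_of_nonneg_left hinv h1Kt
  have h2 := lfb_add h hpert
  have e1 : Ψ + (Ψ' - Ψ) = Ψ' := by abel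
  rwa [e1, ← hadd] at h2

/-! ## Part 3. (scone3): bounds on the unit field from the three local bounds; `𝒮_k(□) ⊂ 𝒫_k(□, δ)` -/

/-- **`‖Φ‖ ≤ q + qα⁻¹` on `S₀`** (the (base1) step for the `E`-valued predicate; at `α = 1`: `2q`, at `α ≤ 1`: `≤ 2qα⁻¹`).
[cite: Dimock2013BalabanII, §3.2 eq. (scone3) L2261–2266 with Lemma 3.1 proof (base1) L2123–2127 (arXiv:1212.5562v2 TeX)] -/
theorem norm_unit_le (h : LocalFieldBounds n q α S₀ S Φ φ) (hS : S₀ ⊆ S) {y : X d} (hy : y ∈ S₀) :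
    ‖Φ y‖ ≤ q + q * α⁻¹ := by
  have hQ : ‖qavgV n φ y‖ ≤ q * α⁻¹ :=
    norm_qavgV_le fun p hp => h.2.2 p (mem_U.2 (by rw [mem_B.1 hp]; exact hS hy))
  calc ‖Φ y‖ = ‖(Φ y - qavgV n φ y) + qavgV n φ y‖ := by rw [sub_add_cancel]
    _ ≤ ‖Φ y - qavgV n φ y‖ + ‖qavgV n φ y‖ := norm_add_le _ _
    _ ≤ q + q * α⁻¹ := add_le_add (h.1 y hy) hQ

/-- **`‖∂Φ‖ ≤ 3q` on the unit bonds of `S₀`** (the (base2) step: `‖Φ(y+e_μ) − Φ(y)‖ ≤ ‖QΦ-differences‖ + 2q`, and the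
difference of block averages is at most `(n+1)·(q∕(n+1)) = q` by `norm_qavgV_sub_le`).
[cite: Dimock2013BalabanII, §3.2 eq. (scone3) L2261–2266 with Lemma 3.1 proof (base2) L2128–2137 (arXiv:1212.5562v2 TeX)] -/
theorem norm_fdUnitV_le (h : LocalFieldBounds n q α S₀ S Φ φ) (hS : S₀ ⊆ S) {μ : Fin d} {y : X d} (hy : y ∈ S₀)
    (hye : y + e μ ∈ S₀) : ‖fdUnitV μ Φ y‖ ≤ 3 * q := by
  have hq : 0 ≤ q := (norm_nonneg _).trans (h.1 y hy)
  have hn : (0 : ℝ) < (n : ℝ) + 1 := by positivity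
  -- the block-average difference
  have hQ : ‖qavgV n φ (y + e μ) - qavgV n φ y‖ ≤ ((n : ℝ) + 1) * (q / ((n : ℝ) + 1)) := by
    refine norm_qavgV_sub_le fun p hp t ht => ?_
    have hpy : blk n p = y := mem_B.1 hp
    have hx : p + (t : ℤ) • e μ ∈ U n S :=
      add_steps_mem_U (by rw [hpy]; exact hS hy) (by rw [hpy]; exact hS hye) ht.le
    have hxe : p + (t : ℤ) • e μ + e μ ∈ U n S := by
      have h2 : p + (t : ℤ) • e μ + e μ = p + ((t + 1 : ℕ) : ℤ) • e μ := by
        rw [Nat.cast_succ, add_smul, one_smul, add_assoc]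
      rw [h2]
      exact add_steps_mem_U (by rw [hpy]; exact hS hy) (by rw [hpy]; exact hS hye) (by omega)
    have hb := h.2.1 μ _ hx hxe
    rw [fdFineV, norm_smul, Real.norm_of_nonneg hn.le] at hb
    rw [le_div_iff₀ hn, mul_comm]
    exact hb
  rw [mul_div_cancel₀ _ hn.ne'] at hQ
  have e1 : fdUnitV μ Φ y = (Φ (y + e μ) - qavgV n φ (y + e μ)) + (qavgV n φ (y + e μ) - qavgV n φ y)
      - (Φ y - qavgV n φ y) := by
    simp only [fdUnitV]; abel
  rw [e1]
  calc ‖(Φ (y + e μ) - qavgV n φ (y + e μ)) + (qavgV n φ (y + e μ) - qavgV n φ y) - (Φ y - qavgV n φ y)‖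
      ≤ ‖(Φ (y + e μ) - qavgV n φ (y + e μ)) + (qavgV n φ (y + e μ) - qavgV n φ y)‖ + ‖Φ y - qavgV n φ y‖ :=
        norm_sub_le _ _
    _ ≤ (‖Φ (y + e μ) - qavgV n φ (y + e μ)‖ + ‖qavgV n φ (y + e μ) - qavgV n φ y‖) + ‖Φ y - qavgV n φ y‖ :=
        add_le_add (norm_add_le _ _) le_rfl
    _ ≤ (q + q) + q := add_le_add (add_le_add (h.1 _ hye) hQ) (h.1 y hy)
    _ = 3 * q := by ring

/-- **(scone3)**: *"As in lemma threeone if the fields are in 𝒫_k(□) then on □̃ ∩ Ω_k  |Φ_k| ≤ 2λ_k^{−1/4−δ},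
|∂Φ_k| ≤ 3λ_k^{−1/4−δ}"* — for the predicate at `α = 1` with bound `q` (= `λ_k^{−1/4−δ}`): `‖Φ‖ ≤ 2q`, `‖∂Φ‖ ≤ 3q`.
[cite: Dimock2013BalabanII, §3.2 eq. (scone3) L2261–2266 (arXiv:1212.5562v2 TeX)] -/
theorem scone3 (h : LocalFieldBounds n q 1 S₀ S Φ φ) (hS : S₀ ⊆ S) :
    (∀ y ∈ S₀, ‖Φ y‖ ≤ 2 * q) ∧
      (∀ μ : Fin d, ∀ y ∈ S₀, y + e μ ∈ S₀ → ‖fdUnitV μ Φ y‖ ≤ 3 * q) := by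
  refine ⟨fun y hy => ?_, fun μ y hy hye => norm_fdUnitV_le h hS hy hye⟩
  have h1 := norm_unit_le h hS hy
  rw [inv_one, mul_one] at h1
  linarith

end Classes

section Inclusion

variable {n : ℕ} {pk αk q : ℝ} {S₀ S : Finset (X d)} {Φ φ : X d → ℝ}

/-- **«Note also that 𝒮_k(□) ⊂ 𝒫_k(□, δ)»** (L2265): a real pair in DEFINITION 3.s's class with parameters `(p_k, α_k)`
lies, read as a complex pair, in the class `(q, 1)` as soon as `p_k ≤ q` and `p_kα_k⁻¹ ≤ q` (`q = λ_k^{−1/4−δ}`).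
[cite: Dimock2013BalabanII, §3.2 L2267 (arXiv:1212.5562v2 TeX)] -/
theorem pDomain_of_localSmallField (h : LocalSmallField n pk αk S₀ S Φ φ) (hq : pk ≤ q) (hqα : pk * αk⁻¹ ≤ q) :
    LocalFieldBounds n q 1 S₀ S (fun x => (Φ x : ℂ)) (fun x => (φ x : ℂ)) := by
  rw [localFieldBounds_ofReal_iff]
  exact lfb_mono₂ (localFieldBounds_real_iff.2 h) hq (by rwa [inv_one, mul_one])

/-- THE TWO SMALLNESS CONDITIONS behind `𝒮_k(□) ⊂ 𝒫_k(□, δ)` from `α_k⁻¹ ≤ λ_k^{−1/4}` (as `α_k ≥ λ_k^{1/4}`, L2056–2058 with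
L2080–2081) and `p_k ≤ λ_k^{−δ}` (*"λ_k sufficiently small"*), `0 < λ_k ≤ 1`: then `p_k ≤ λ_k^{−(1/4+δ)}` and
`p_kα_k⁻¹ ≤ λ_k^{−(1/4+δ)}`.
[cite: Dimock2013BalabanII, §3.2 L2267 with L2080–2081 (arXiv:1212.5562v2 TeX)] -/
theorem inclusion_arith {pk ak lam δ : ℝ} (hlam : 0 < lam) (hlam1 : lam ≤ 1)
    (hα : ak⁻¹ ≤ lam ^ (-(1 / 4 : ℝ))) (hak : 0 < ak) (hp : pk ≤ lam ^ (-δ)) :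
    pk ≤ lam ^ (-(1 / 4 + δ)) ∧ pk * ak⁻¹ ≤ lam ^ (-(1 / 4 + δ)) := by
  have hsplit : lam ^ (-(1 / 4 + δ)) = lam ^ (-δ) * lam ^ (-(1 / 4 : ℝ)) := by
    rw [← Real.rpow_add hlam]; congr 1; ring
  have hq1 : 1 ≤ lam ^ (-(1 / 4 : ℝ)) := Real.one_le_rpow_of_pos_of_le_one_of_nonpos hlam hlam1 (by norm_num)
  have hδ0 : 0 ≤ lam ^ (-δ) := (Real.rpow_pos_of_pos hlam _).le
  refine ⟨?_, ?_⟩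
  · rw [hsplit]
    calc pk = pk * 1 := (mul_one _).symm
      _ ≤ lam ^ (-δ) * lam ^ (-(1 / 4 : ℝ)) := mul_le_mul hp hq1 zero_le_one hδ0
  · rw [hsplit]
    exact mul_le_mul hp hα (inv_pos.2 hak).le hδ0

/-- `α_k⁻¹ ≤ λ_k^{−1/4}` for the tree's `α_k = ConstantFieldSplit.alpha μ̄_k λ_k = max(μ̄_k^{1/2}, λ_k^{1/4})` (*"Since α_k^{−1} =
min{μ̄_k^{−1/2}, λ_k^{−1/4}} ≤ λ_k^{−1/4}"*, L2080–2081).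
[cite: Dimock2013BalabanII, §3.2 L2056–2058, L2080–2081 (arXiv:1212.5562v2 TeX)] -/
theorem inv_alpha_le_rpow (μ : ℝ) {lam : ℝ} (hlam : 0 < lam) : (alpha μ lam)⁻¹ ≤ lam ^ (-(1 / 4 : ℝ)) := by
  rw [Real.rpow_neg hlam.le]
  exact inv_anti₀ (Real.rpow_pos_of_pos hlam _) (le_max_right _ _)

/-- **«λ_k sufficiently small» FOR `p_k ≤ λ_k^{−δ}` MADE EXPLICIT**: with `p_k = (−log λ_k)^p`, `p, δ > 0`: if `−log λ_k ≥
4p²∕δ²` then `(−log λ_k)^p ≤ λ_k^{−δ}` (from `log x ≤ 2(√x − 1) < 2√x` and `2p√x ≤ δx`).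
[cite: Dimock2013BalabanII, §3.2 L2050–2053 with L2267 (arXiv:1212.5562v2 TeX)] -/
theorem log_pow_le_rpow_neg {p δ lam : ℝ} (hp : 0 < p) (hδ : 0 < δ) (hlam : 0 < lam)
    (hsmall : 4 * p ^ 2 / δ ^ 2 ≤ -Real.log lam) : (-Real.log lam) ^ p ≤ lam ^ (-δ) := by
  set x := -Real.log lam with hx
  have h4 : 0 < 4 * p ^ 2 / δ ^ 2 := by positivity
  have hx0 : 0 < x := h4.trans_le hsmall
  have hsx : 0 < Real.sqrt x := Real.sqrt_pos.2 hx0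
  -- `log x ≤ 2√x`
  have hlog : Real.log x ≤ 2 * Real.sqrt x := by
    have h1 := Real.log_le_sub_one_of_pos hsx
    rw [Real.log_sqrt hx0.le] at h1
    linarith
  -- `2p√x ≤ δx` from `4p² ≤ δ²x`
  have hδx : 2 * p * Real.sqrt x ≤ δ * x := by
    have h2 : 4 * p ^ 2 ≤ δ ^ 2 * x := by
      have := (div_le_iff₀ (by positivity : (0 : ℝ) < δ ^ 2)).1 hsmall
      linarith
    have h3 : (2 * p) ^ 2 ≤ (δ * Real.sqrt x) ^ 2 := by
      rw [mul_pow, mul_pow, Real.sq_sqrt hx0.le]; linarith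
    have h4' : |2 * p| ≤ |δ * Real.sqrt x| := sq_le_sq.1 h3
    rw [abs_of_pos (by positivity), abs_of_pos (by positivity)] at h4'
    calc 2 * p * Real.sqrt x ≤ δ * Real.sqrt x * Real.sqrt x := mul_le_mul_of_nonneg_right h4' hsx.le
      _ = δ * x := by rw [mul_assoc, Real.mul_self_sqrt hx0.le]
  have hkey : p * Real.log x ≤ δ * x := by nlinarith
  rw [Real.rpow_def_of_pos hx0, Real.rpow_def_of_pos hlam, Real.exp_le_exp]
  have e1 : Real.log lam * -δ = δ * x := by rw [hx]; ring
  rw [e1, mul_comm]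
  exact hkey

/-- **`𝒮_k(□) ⊂ 𝒫_k(□, δ)` WITH THE TREE's PARAMETERS**: `p_k = (−log λ_k)^p`, `α_k = alpha μ̄_k λ_k`, `0 < λ_k ≤ 1`, and the
explicit smallness `−log λ_k ≥ 4p²∕δ²`: a real pair in DEFINITION 3.s's class lies in the complex domain with bound
`λ_k^{−(1/4+δ)}`.
[cite: Dimock2013BalabanII, §3.2 L2267 (arXiv:1212.5562v2 TeX)] -/
theorem pDomain_of_localSmallField_explicit {p δ lam μ : ℝ} (hp : 0 < p) (hδ : 0 < δ) (hlam : 0 < lam)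
    (hlam1 : lam ≤ 1) (hsmall : 4 * p ^ 2 / δ ^ 2 ≤ -Real.log lam)
    (h : LocalSmallField n ((-Real.log lam) ^ p) (alpha μ lam) S₀ S Φ φ) :
    LocalFieldBounds n (lam ^ (-(1 / 4 + δ))) 1 S₀ S (fun x => (Φ x : ℂ)) (fun x => (φ x : ℂ)) := by
  have har := inclusion_arith hlam hlam1 (inv_alpha_le_rpow μ hlam) (alpha_pos hlam)
    (log_pow_le_rpow_neg hp hδ hlam hsmall)
  exact pDomain_of_localSmallField h har.1 har.2

end Inclusion

/-! ## Part 4. The printed domains as instances of the predicate -/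

section Domains

variable {n : ℕ}

/-- **DEFINITION (lamp), SCALED: `c𝒫_k(□, δ)`** — all complex-valued (`E`-valued) pairs with `‖Φ_k − Q_kφ_{k,Ω(□)}‖ ≤
cλ_k^{−1/4−δ}` on `□̃ ∩ Ω_k` (unit points `S₀`), `‖∂φ_{k,Ω(□)}‖ ≤ cλ_k^{−1/4−δ}` and `‖φ_{k,Ω(□)}‖ ≤ cλ_k^{−1/4−δ}` on `□̃`
(cubes `S`); `c = 1` is the domain, `c = ½` the domain `½𝒫_k(□, δ)` of LEMMA 3.14's conclusion.
[cite: Dimock2013BalabanII, §3.2 Definition (lamp) L2245–2258; §3.11.3 Lemma 3.14 L4196–4197 (arXiv:1212.5562v2 TeX)] -/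
abbrev PDomain (n : ℕ) (c lam δ : ℝ) (S₀ S : Finset (X d)) (Φ φ : X d → E) : Prop :=
  LocalFieldBounds n (c * lam ^ (-(1 / 4 + δ))) 1 S₀ S Φ φ

/-- **(startrek), SCALED: `c𝒫⁰_{k+1}(□, δ)`** for an `LM`-cube `□ ⊂ Ω_{k+1}`, read on the `L`-block carrier (block side
`n + 1 = L^{k+1}` fine sites, derivative in `L`-block units, as (not) in `RedundantCharacteristicFunctions` reading (i)):
the three bounds `cλ_{k+1}^{−1/4−δ}L^{−1/2}` (the printed `|∂φ| ≤ λ_{k+1}^{−1/4−δ}L^{−3/2}` in `L^{−k}`-units is `≤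
λ_{k+1}^{−1/4−δ}L^{−1/2}` in `L`-block units).
[cite: Dimock2013BalabanII, §3.11.3 eq. (startrek) L4168–4176 (arXiv:1212.5562v2 TeX)] -/
abbrev PDomain0 (n : ℕ) (c lam L δ : ℝ) (T₀ T : Finset (X d)) (Φ φ : X d → E) : Prop :=
  LocalFieldBounds n (c * (lam ^ (-(1 / 4 + δ)) * L ^ (-(1 / 2 : ℝ)))) 1 T₀ T Φ φ

/-- `𝒫_k(X, δ) = ∩_{□ ⊂ X} 𝒫_k(□, δ)` (L2255–2257) as a conjunction over an index set of cubes, each cube `i` carrying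
its unit points `S₀ i` (`□̃ ∩ Ω_k`), its cubes `S i` (`□̃`) and its own fine field `φ i` (`φ_{k,Ω(□)}`).
[cite: Dimock2013BalabanII, §3.2 Definition (lamp) L2255–2257; §3.11.3 L4177–4179 (arXiv:1212.5562v2 TeX)] -/
def PDomainX {ι : Type*} (cubes : Finset ι) (n : ℕ) (c lam δ : ℝ) (S₀ S : ι → Finset (X d)) (Φ : X d → E)
    (φ : ι → X d → E) : Prop :=
  ∀ i ∈ cubes, PDomain n c lam δ (S₀ i) (S i) Φ (φ i)

/-- *"Note also that 𝒫_k(Ω^♮_k, 2δ) is contained in 𝒫_k(Λ_k, 2δ)"* (L4217–4218; `Λ_k ⊂ Ω^♮_k`): fewer cubes, fewer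
conditions.
[cite: Dimock2013BalabanII, §3.11.3 Lemma 3.14 Remark 1 L4217–4218 (arXiv:1212.5562v2 TeX)] -/
theorem pDomainX_mono {ι : Type*} {cubes cubes' : Finset ι} {c lam δ : ℝ} {S₀ S : ι → Finset (X d)} {Φ : X d → E}
    {φ : ι → X d → E} (h : PDomainX cubes n c lam δ S₀ S Φ φ) (hsub : cubes' ⊆ cubes) :
    PDomainX cubes' n c lam δ S₀ S Φ φ := fun i hi => h i (hsub hi)

/-- (scone3) for `𝒫_k(□, δ)`: `‖Φ_k‖ ≤ 2λ_k^{−1/4−δ}`, `‖∂Φ_k‖ ≤ 3λ_k^{−1/4−δ}` on `□̃ ∩ Ω_k`.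
[cite: Dimock2013BalabanII, §3.2 eq. (scone3) L2261–2266 (arXiv:1212.5562v2 TeX)] -/
theorem scone3_pDomain {lam δ : ℝ} {S₀ S : Finset (X d)} {Φ φ : X d → E} (h : PDomain n 1 lam δ S₀ S Φ φ)
    (hS : S₀ ⊆ S) :
    (∀ y ∈ S₀, ‖Φ y‖ ≤ 2 * lam ^ (-(1 / 4 + δ))) ∧
      (∀ μ : Fin d, ∀ y ∈ S₀, y + e μ ∈ S₀ → ‖fdUnitV μ Φ y‖ ≤ 3 * lam ^ (-(1 / 4 + δ))) := by
  have h' : LocalFieldBounds n (lam ^ (-(1 / 4 + δ))) 1 S₀ S Φ φ := by rwa [PDomain, one_mul] at h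
  exact scone3 h' hS

/-- **(somewhat)** (L4202–4210), the three sup bounds on the domain (sandy) — each is (scone3)'s first clause for the
respective factor: `𝒫′_k(·, δ)` gives `‖Φ_k‖ ≤ 2λ_k^{−1/4−δ}`, `𝒫⁰_{k+1}(·, δ)` gives `‖Φ_{k+1}‖ ≤ 2λ_{k+1}^{−1/4−δ}L^{−1/2}`,
`𝒫⁰_{k+1}(·, 2δ)` gives `‖Φ_{k+1}‖ ≤ 2λ_{k+1}^{−1/4−2δ}L^{−1/2}` (stated for `𝒫⁰` with a general `δ′`).
[cite: Dimock2013BalabanII, §3.11.3 Lemma 3.14 Remark 1 eq. (somewhat) L4202–4210 (arXiv:1212.5562v2 TeX)] -/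
theorem somewhat {lam L δ' : ℝ} {T₀ T : Finset (X d)} {Φ φ : X d → E} (h : PDomain0 n 1 lam L δ' T₀ T Φ φ)
    (hT : T₀ ⊆ T) : ∀ u ∈ T₀, ‖Φ u‖ ≤ 2 * (lam ^ (-(1 / 4 + δ')) * L ^ (-(1 / 2 : ℝ))) := by
  have h' : LocalFieldBounds n (lam ^ (-(1 / 4 + δ')) * L ^ (-(1 / 2 : ℝ))) 1 T₀ T Φ φ := by
    rwa [PDomain0, one_mul] at h
  exact (scone3 h' hT).1

end Domains

/-! ## Part 5. LEMMA 3.14 `technical`: the bookkeeping of cases (A), (B), (C) and the assembly over `Ω^♮_k` -/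

section CaseA

variable {n : ℕ} {q ε : ℝ} {T₀ T S₀ S : Finset (X d)} {Φ' φsq φ' : X d → E}

/-- **(lamp1) ⟹ (lamp2)** (L4231–4256): (lamp1) = `(Φ_{k+1}, φ⁰_{k+1,Ω⁺(□)})` in the class `q` (`q = λ_{k+1}^{−1/4−2δ}L^{−1/2}`,
`L`-block carrier, `α = 1`) and the (note9) bounds `‖φ⁰_□ − φ⁰_{Ω′}‖, ‖∂(φ⁰_□ − φ⁰_{Ω′})‖ ≤ ε` with *"for M large"* =
`ε ≤ q` give `(Φ_{k+1}, φ⁰_{k+1,Ω′})` in the class `2q`: *"|Φ_{k+1} − Q_{k+1}φ⁰_{k+1,Ω′}|, |∂φ⁰_{k+1,Ω′}|, |φ⁰_{k+1,Ω′}| ≤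
2λ_{k+1}^{−1/4−2δ}L^{−1/2}"*.
[cite: Dimock2013BalabanII, §3.11.3 Lemma 3.14 proof (A) eqs. (lamp1), (note9), (lamp2) L4231–4256 (arXiv:1212.5562v2 TeX)] -/
theorem lamp2 (hT : T₀ ⊆ T) (h : LocalFieldBounds n q 1 T₀ T Φ' φsq)
    (hδ : ∀ x ∈ U n T, ‖(φ' - φsq) x‖ ≤ ε)
    (hdδ : ∀ μ : Fin d, ∀ x ∈ U n T, x + e μ ∈ U n T → ‖fdFineV n μ (φ' - φsq) x‖ ≤ ε) (hε : ε ≤ q) :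
    LocalFieldBounds n (2 * q) 1 T₀ T Φ' φ' :=
  lfb_mono zero_le_one (lfb_fine_replacement one_pos le_rfl hT h hδ hdδ) (by linarith)

/-- **THE FIELD `Ψ_{k,Ω_{k+1}}(Ω′)` FROM `Φ_{k+1}` AND `φ⁰_{k+1,Ω′}`** ((ding3) of §3.7, `E`-valued): `Ψ(y) = (Q_kφ)(y) + c·(Φ_{k+1} −
Q_{k+1}φ)(blk_L y)`, `c = aL^{−2}∕(a_k + aL^{−2})`, on the two-level carrier (`L = m+1` unit points per `L`-block side,
`n′+1` fine sites per unit side, `n+1 = (m+1)(n′+1)`).  At `E = ℝ` it is `RedundantCharacteristicFunctions.psiOf`.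
[cite: Dimock2013BalabanII, §3.7 eq. (ding3), quoted in §3.11.2 L4119–4123; §3.11.3 L4258–4262 (arXiv:1212.5562v2 TeX)] -/
def psiOfV (m n' : ℕ) (c : ℝ) (Φ' φ₀ : X d → E) : X d → E := fun y =>
  qavgV n' φ₀ y + c • (Φ' (blk m y) - qavgV (m * n' + m + n') φ₀ (blk m y))

/-- at `E = ℝ`, `psiOfV = psiOf`.
[cite: Dimock2013BalabanII, §3.7 eq. (ding3), quoted in §3.11.2 L4119–4123 (arXiv:1212.5562v2 TeX)] -/
theorem psiOfV_real (m n' : ℕ) (c : ℝ) (Φ' φ₀ : X d → ℝ) : psiOfV m n' c Φ' φ₀ = psiOf m n' c Φ' φ₀ := by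
  funext y
  simp [psiOfV, psiOf, qavgV_real, smul_eq_mul]

/-- `Ψ − Q_kφ = c·(Φ_{k+1} − Q_{k+1}φ)∘blk_L` pointwise.
[cite: Dimock2013BalabanII, §3.11.3 Lemma 3.14 proof (A) L4258–4260 (arXiv:1212.5562v2 TeX)] -/
theorem psiOfV_sub_qavgV (m n' : ℕ) (c : ℝ) (Φ' φ₀ : X d → E) (y : X d) :
    psiOfV m n' c Φ' φ₀ y - qavgV n' φ₀ y = c • (Φ' (blk m y) - qavgV (m * n' + m + n') φ₀ (blk m y)) := by
  simp only [psiOfV]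
  abel

/-- the two normalisations of `∂`: in `L`-block units the fine derivative is `(m+1)` times the derivative in unit
units.
[cite: Dimock2013BalabanII, §3.10 eq. (not) L3610–3617 with L3619–3622 (arXiv:1212.5562v2 TeX)] -/
theorem fdFineV_two_level (m n' : ℕ) (μ : Fin d) (f : X d → E) (x : X d) :
    fdFineV (m * n' + m + n') μ f x = (((m : ℝ) + 1) : ℝ) • fdFineV n' μ f x := by
  simp only [fdFineV, smul_smul]
  congr 1
  push_cast
  ring

/-- **(lamp2) ⟹ (lamp3)** (L4258–4268): *"Now replace |Φ_{k+1} − Q_{k+1}φ⁰_{k+1,Ω′}| by the smaller |Ψ_{k,Ω_{k+1}}(Ω′) −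
Q_kφ⁰_{k+1,Ω′}| and use the identity φ⁰_{k+1,Ω′} = φ_{k,Ω(Λ*_k)}(Ψ̂_{k,Ω′}) which still holds with complex fields"*: if
`(Φ_{k+1}, φ)` is in the class `q` on the `L`-block labels `T₀ ⊆ T` then, for `0 ≤ c ≤ 1`, `(Ψ, φ)` with `Ψ = psiOfV m n′ c
Φ_{k+1} φ` is in the class `q` on the unit points of those blocks (the fine field is the same function, so the printed
identity enters only as the name of `φ`).
[cite: Dimock2013BalabanII, §3.11.3 Lemma 3.14 proof (A) eq. (lamp3) L4258–4268 (arXiv:1212.5562v2 TeX)] -/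
theorem lamp3 {m n' : ℕ} {c : ℝ} {T₀ T : Finset (X d)} {Φ' φ₀ : X d → E} (hc0 : 0 ≤ c) (hc1 : c ≤ 1)
    (h : LocalFieldBounds (m * n' + m + n') q 1 T₀ T Φ' φ₀) :
    LocalFieldBounds n' q 1 (U m T₀) (U m T) (psiOfV m n' c Φ' φ₀) φ₀ := by
  refine ⟨fun y hy => ?_, fun μ x hx hxe => ?_, fun x hx => ?_⟩
  · have hu : blk m y ∈ T₀ := mem_U.1 hy
    have hb := h.1 _ hu
    rw [psiOfV_sub_qavgV, norm_smul, Real.norm_of_nonneg hc0]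
    calc c * ‖Φ' (blk m y) - qavgV (m * n' + m + n') φ₀ (blk m y)‖ ≤ 1 * q :=
        mul_le_mul hc1 hb (norm_nonneg _) zero_le_one
      _ = q := one_mul q
  · have hx' : x ∈ U (m * n' + m + n') T := by rw [U_comp]; exact hx
    have hxe' : x + e μ ∈ U (m * n' + m + n') T := by rw [U_comp]; exact hxe
    have hb := h.2.1 μ x hx' hxe'
    have hq : 0 ≤ q := (norm_nonneg _).trans hb
    rw [fdFineV_two_level, norm_smul, Real.norm_of_nonneg (by positivity : (0 : ℝ) ≤ (m : ℝ) + 1)] at hb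
    have hm : (0 : ℝ) ≤ (m : ℝ) := Nat.cast_nonneg m
    nlinarith [norm_nonneg (fdFineV n' μ φ₀ x)]
  · have hx' : x ∈ U (m * n' + m + n') T := by rw [U_comp]; exact hx
    exact h.2.2 x hx'

variable {n' : ℕ} {U₀ U₁ : Finset (X d)} {Ψ φ₀ φmin Ψloc : X d → E}

/-- **(lamp3) ⟹ (lamp4)** (L4270–4287): the (note8) replacement `φ_{k,Ω(Λ*_k)}(Ψ̂_{k,Ω′}) ↦ φ^{min}_{k,Ω(□)}` with bounds `≤ ε ≤
q` (*"for M large"*) takes the class `2q` to `3q`: *"|Ψ − Q_kφ^{min}|, |∂φ^{min}|, |φ^{min}| ≤ 3λ_{k+1}^{−1/4−2δ}L^{−1/2}"*.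
[cite: Dimock2013BalabanII, §3.11.3 Lemma 3.14 proof (A) eqs. (note8), (lamp4) L4270–4284 (arXiv:1212.5562v2 TeX)] -/
theorem lamp4 (hU : U₀ ⊆ U₁) (h : LocalFieldBounds n' (2 * q) 1 U₀ U₁ Ψ φ₀)
    (hδ : ∀ x ∈ U n' U₁, ‖(φmin - φ₀) x‖ ≤ ε)
    (hdδ : ∀ μ : Fin d, ∀ x ∈ U n' U₁, x + e μ ∈ U n' U₁ → ‖fdFineV n' μ (φmin - φ₀) x‖ ≤ ε) (hε : ε ≤ q) :
    LocalFieldBounds n' (3 * q) 1 U₀ U₁ Ψ φmin :=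
  lfb_mono zero_le_one (lfb_fine_replacement one_pos le_rfl hU h hδ hdδ) (by linarith)

/-- **«The same holds with Ψ̂_{k,Ω′} replaced by Ψ̂^{loc}_{k,Ω′} and 4λ_{k+1}^{−1/4−2δ}L^{−1/2} on the right side»** (L4288–4289):
with the local minimizer `bg = Ψ ↦ φ^{min}_{k,Ω(□)}(Ψ)` additive on the pair, `‖Ψ^{loc} − Ψ‖ ≤ t` on the unit points and
`‖bg(Ψ^{loc} − Ψ)‖, ‖∂bg(Ψ^{loc} − Ψ)‖ ≤ Kt`, the class `3q` becomes `4q` as soon as `(1 + K)t ≤ q`.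
[cite: Dimock2013BalabanII, §3.11.3 Lemma 3.14 proof (A) L4285–4286 (arXiv:1212.5562v2 TeX)] -/
theorem lamp4_loc {t K : ℝ} {bg : (X d → E) → X d → E} (hU : U₀ ⊆ U₁) (hK : 0 ≤ K) (ht : 0 ≤ t)
    (h : LocalFieldBounds n' (3 * q) 1 U₀ U₁ Ψ (bg Ψ)) (hadd : bg Ψloc = bg Ψ + bg (Ψloc - Ψ))
    (hδ : ∀ y ∈ U₀, ‖(Ψloc - Ψ) y‖ ≤ t) (hbg : ∀ x ∈ U n' U₁, ‖bg (Ψloc - Ψ) x‖ ≤ K * t)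
    (hdbg : ∀ μ : Fin d, ∀ x ∈ U n' U₁, x + e μ ∈ U n' U₁ → ‖fdFineV n' μ (bg (Ψloc - Ψ)) x‖ ≤ K * t)
    (hsmall : (1 + K) * t ≤ q) :
    LocalFieldBounds n' (4 * q) 1 U₀ U₁ Ψloc (bg Ψloc) :=
  lfb_mono zero_le_one (lfb_unit_perturbation one_pos le_rfl hU hK ht h hadd hδ hbg hdbg) (by linarith)

/-- **CASE (A)'s ARITHMETIC** (L4289–4290): *"But for L large, 4λ_{k+1}^{−1/4−2δ}L^{−1/2} = 4λ_k^{−1/4−2δ}L^{−3/4−2δ} ≤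
½λ_k^{−1/4−2δ}"* with `λ_{k+1} = Lλ_k` and *"L large"* = `8 ≤ L^{3/4+2δ}`.
[cite: Dimock2013BalabanII, §3.11.3 Lemma 3.14 proof (A) L4286–4288 (arXiv:1212.5562v2 TeX)] -/
theorem caseA_arith {lam L δ : ℝ} (hlam : 0 < lam) (hL : 0 < L) (hbig : 8 ≤ L ^ (3 / 4 + 2 * δ)) :
    4 * ((L * lam) ^ (-(1 / 4 + 2 * δ)) * L ^ (-(1 / 2 : ℝ))) ≤ 1 / 2 * lam ^ (-(1 / 4 + 2 * δ)) := by
  have hsplit : (L * lam) ^ (-(1 / 4 + 2 * δ)) * L ^ (-(1 / 2 : ℝ))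
      = L ^ (-(3 / 4 + 2 * δ)) * lam ^ (-(1 / 4 + 2 * δ)) := by
    rw [Real.mul_rpow hL.le hlam.le, mul_right_comm, ← Real.rpow_add hL]
    congr 1
    congr 1
    ring
  rw [hsplit, ← mul_assoc]
  refine mul_le_mul_of_nonneg_right ?_ (Real.rpow_pos_of_pos hlam _).le
  have hpos : 0 < L ^ (3 / 4 + 2 * δ) := Real.rpow_pos_of_pos hL _
  rw [Real.rpow_neg hL.le, ← div_eq_mul_inv, div_le_iff₀ hpos]
  linarith

/-- *"L large"* is inhabited for every `δ ≥ 0` by `L = 16`: `16^{3/4+2δ} ≥ 16^{3/4} = 8`.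
[cite: Dimock2013BalabanII, §3.11.3 Lemma 3.14 proof (A) L4286 (arXiv:1212.5562v2 TeX)] -/
theorem caseA_condition_sixteen {δ : ℝ} (hδ : 0 ≤ δ) : (8 : ℝ) ≤ 16 ^ (3 / 4 + 2 * δ) := by
  have h1 : (16 : ℝ) ^ (3 / 4 : ℝ) = 8 := by
    rw [show (16 : ℝ) = 2 ^ (4 : ℝ) by norm_num, ← Real.rpow_mul (by norm_num)]
    norm_num
  calc (8 : ℝ) = 16 ^ (3 / 4 : ℝ) := h1.symm
    _ ≤ 16 ^ (3 / 4 + 2 * δ) := Real.rpow_le_rpow_of_exponent_le (by norm_num) (by linarith)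

/-- **CASE (A) CONCLUDED** (L4288–4291): the class `4q₁`, `q₁ = λ_{k+1}^{−1/4−2δ}L^{−1/2}`, `λ_{k+1} = Lλ_k`, lies in
`½𝒫_k(□, 2δ)` for `8 ≤ L^{3/4+2δ}`: *"Thus we have Ψ^{loc}_{k,Ω_{k+1}}(Ω′) ∈ ½𝒫_k(□, 2δ) as required"*.
[cite: Dimock2013BalabanII, §3.11.3 Lemma 3.14 proof (A) L4285–4289 (arXiv:1212.5562v2 TeX)] -/
theorem caseA {lam L δ : ℝ} {φfin : X d → E} (hlam : 0 < lam) (hL : 0 < L) (hbig : 8 ≤ L ^ (3 / 4 + 2 * δ))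
    (h : LocalFieldBounds n' (4 * ((L * lam) ^ (-(1 / 4 + 2 * δ)) * L ^ (-(1 / 2 : ℝ)))) 1 U₀ U₁ Ψloc φfin) :
    PDomain n' (1 / 2) lam (2 * δ) U₀ U₁ Ψloc φfin := by
  have h1 := caseA_arith hlam hL hbig
  have e1 : -(1 / 4 + 2 * δ) = -(1 / 4 + 2 * δ) := rfl
  exact lfb_mono zero_le_one h (by rw [e1] at h1; exact h1)

/-- **CASE (A) FROM ITS PRINTED INPUTS, IN ONE STROKE** (L4231–4291): (lamp1) = `(Φ_{k+1}, φ⁰_{k+1,Ω⁺(□)}) ∈ 𝒫⁰_{k+1}(·, 2δ)` on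
the `L`-blocks `T₀ ⊆ T` (level-`(k+1)` coupling `λ_{k+1} = Lλ_k`), the (note9) replacement `φ⁰_{Ω⁺(□)} ↦ φ⁰_{Ω′}` (`ε₁ ≤ q₁`),
(ding3) `Ψ = psiOfV m n′ c Φ_{k+1} φ⁰_{Ω′}` with `0 ≤ c ≤ 1`, restriction to the `M`-cube's unit points `U₀ ⊆ U₁`, the
(note8) replacement `φ⁰_{Ω′} = φ_{k,Ω(Λ*_k)}(Ψ̂) ↦ φ^{min}_{k,Ω(□)} = bg Ψ` (`ε₂ ≤ q₁`), and the `Ψ̂ ↦ Ψ̂^{loc}` step (`(1+K)t ≤ q₁`)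
give `(Ψ^{loc}, φ^{min}_{k,Ω(□)}(Ψ^{loc})) ∈ ½𝒫_k(□, 2δ)` for `8 ≤ L^{3/4+2δ}`; here `q₁ = λ_{k+1}^{−1/4−2δ}L^{−1/2}`.
[cite: Dimock2013BalabanII, §3.11.3 Lemma 3.14 proof (A) L4231–4289 (arXiv:1212.5562v2 TeX)] -/
theorem caseA_chain {m : ℕ} {c lam L δ ε₁ ε₂ t K : ℝ} {Φ' φsq : X d → E} {bg : (X d → E) → X d → E}
    (hlam : 0 < lam) (hL : 0 < L) (hbig : 8 ≤ L ^ (3 / 4 + 2 * δ)) (hT : T₀ ⊆ T) (hc0 : 0 ≤ c) (hc1 : c ≤ 1)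
    (h1 : PDomain0 (m * n' + m + n') 1 (L * lam) L (2 * δ) T₀ T Φ' φsq)
    (hδ₁ : ∀ x ∈ U (m * n' + m + n') T, ‖(φ₀ - φsq) x‖ ≤ ε₁)
    (hdδ₁ : ∀ μ : Fin d, ∀ x ∈ U (m * n' + m + n') T, x + e μ ∈ U (m * n' + m + n') T →
      ‖fdFineV (m * n' + m + n') μ (φ₀ - φsq) x‖ ≤ ε₁)
    (hε₁ : ε₁ ≤ (L * lam) ^ (-(1 / 4 + 2 * δ)) * L ^ (-(1 / 2 : ℝ)))
    (hU : U₀ ⊆ U₁) (hU₀ : U₀ ⊆ U m T₀) (hU₁ : U₁ ⊆ U m T)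
    (hbgΨ : ∀ x ∈ U n' U₁, ‖(bg (psiOfV m n' c Φ' φ₀) - φ₀) x‖ ≤ ε₂)
    (hdbgΨ : ∀ μ : Fin d, ∀ x ∈ U n' U₁, x + e μ ∈ U n' U₁ →
      ‖fdFineV n' μ (bg (psiOfV m n' c Φ' φ₀) - φ₀) x‖ ≤ ε₂)
    (hε₂ : ε₂ ≤ (L * lam) ^ (-(1 / 4 + 2 * δ)) * L ^ (-(1 / 2 : ℝ)))
    (hK : 0 ≤ K) (ht : 0 ≤ t)
    (hadd : bg Ψloc = bg (psiOfV m n' c Φ' φ₀) + bg (Ψloc - psiOfV m n' c Φ' φ₀))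
    (hδ : ∀ y ∈ U₀, ‖(Ψloc - psiOfV m n' c Φ' φ₀) y‖ ≤ t)
    (hbg : ∀ x ∈ U n' U₁, ‖bg (Ψloc - psiOfV m n' c Φ' φ₀) x‖ ≤ K * t)
    (hdbg : ∀ μ : Fin d, ∀ x ∈ U n' U₁, x + e μ ∈ U n' U₁ →
      ‖fdFineV n' μ (bg (Ψloc - psiOfV m n' c Φ' φ₀)) x‖ ≤ K * t)
    (hsmall : (1 + K) * t ≤ (L * lam) ^ (-(1 / 4 + 2 * δ)) * L ^ (-(1 / 2 : ℝ))) :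
    PDomain n' (1 / 2) lam (2 * δ) U₀ U₁ Ψloc (bg Ψloc) := by
  set q₁ : ℝ := (L * lam) ^ (-(1 / 4 + 2 * δ)) * L ^ (-(1 / 2 : ℝ)) with hq₁
  have h1' : LocalFieldBounds (m * n' + m + n') q₁ 1 T₀ T Φ' φsq := by
    have h := h1
    rw [PDomain0, one_mul] at h
    exact h
  -- (lamp2) on the `L`-blocks, (lamp3) on all their unit points, restricted to the `M`-cube
  have h2 := lamp2 hT h1' hδ₁ hdδ₁ hε₁
  have h3 : LocalFieldBounds n' (2 * q₁) 1 U₀ U₁ (psiOfV m n' c Φ' φ₀) φ₀ := (lamp3 hc0 hc1 h2).mono hU₀ hU₁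
  -- (lamp4) with `φ^{min} = bg Ψ`, then the `loc` step
  have h4 : LocalFieldBounds n' (3 * q₁) 1 U₀ U₁ (psiOfV m n' c Φ' φ₀) (bg (psiOfV m n' c Φ' φ₀)) :=
    lamp4 hU h3 hbgΨ hdbgΨ hε₂
  have h5 := lamp4_loc hU hK ht h4 hadd hδ hbg hdbg hsmall
  exact caseA hlam hL hbig h5

end CaseA

section CaseB

variable {n' : ℕ} {U₀ U₁ : Finset (X d)} {Ψ φmin : X d → E}

/-- **CASES (B)∕(C)'s ARITHMETIC** (L4309–4310, L4313–4320): *"for λ_k sufficiently small Cλ_{k+1}^{−1/4−δ} ≤ ½λ_k^{−1/4−2δ}"*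
with `λ_{k+1} = Lλ_k`, `L ≥ 1`, `δ ≥ 0` and *"λ_k sufficiently small"* = `2Cλ_k^δ ≤ 1`.
[cite: Dimock2013BalabanII, §3.11.3 Lemma 3.14 proof (B) L4310, (C) L4313–4320 (arXiv:1212.5562v2 TeX)] -/
theorem caseB_arith {C lam L δ : ℝ} (hC : 0 ≤ C) (hlam : 0 < lam) (hL : 1 ≤ L) (hδ : 0 ≤ δ)
    (hsmall : 2 * C * lam ^ δ ≤ 1) :
    C * (L * lam) ^ (-(1 / 4 + δ)) ≤ 1 / 2 * lam ^ (-(1 / 4 + 2 * δ)) := by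
  have hL0 : 0 < L := by linarith
  -- `(Lλ)^{−(1/4+δ)} ≤ λ^{−(1/4+δ)}`
  have h1 : (L * lam) ^ (-(1 / 4 + δ)) ≤ lam ^ (-(1 / 4 + δ)) := by
    rw [Real.mul_rpow hL0.le hlam.le]
    have hL1 : L ^ (-(1 / 4 + δ)) ≤ 1 := Real.rpow_le_one_of_one_le_of_nonpos hL (by linarith)
    calc L ^ (-(1 / 4 + δ)) * lam ^ (-(1 / 4 + δ)) ≤ 1 * lam ^ (-(1 / 4 + δ)) :=
        mul_le_mul_of_nonneg_right hL1 (Real.rpow_pos_of_pos hlam _).le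
      _ = lam ^ (-(1 / 4 + δ)) := one_mul _
  -- `λ^{−(1/4+δ)} = λ^δ · λ^{−(1/4+2δ)}`
  have h2 : lam ^ (-(1 / 4 + δ)) = lam ^ δ * lam ^ (-(1 / 4 + 2 * δ)) := by
    rw [← Real.rpow_add hlam]; congr 1; ring
  have hpos : 0 < lam ^ (-(1 / 4 + 2 * δ)) := Real.rpow_pos_of_pos hlam _
  calc C * (L * lam) ^ (-(1 / 4 + δ)) ≤ C * lam ^ (-(1 / 4 + δ)) := mul_le_mul_of_nonneg_left h1 hC
    _ = (C * lam ^ δ) * lam ^ (-(1 / 4 + 2 * δ)) := by rw [h2, mul_assoc]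
    _ ≤ 1 / 2 * lam ^ (-(1 / 4 + 2 * δ)) := mul_le_mul_of_nonneg_right (by linarith) hpos.le

/-- **CASES (B)∕(C) CONCLUDED** (L4293–4322): a pair in the class `Cλ_{k+1}^{−1/4−δ}` (the shape of (lamp5): *"|Ψ − Q_kφ^{min}|,
|∂φ^{min}|, |φ^{min}| ≤ Cλ_{k+1}^{−1/4−δ}"*, resp. of (lamp6) with `Φ_k` in place of `Ψ`) lies in `½𝒫_k(□, 2δ)` under the
smallness `2Cλ_k^δ ≤ 1`: *"This gives the result since for λ_k sufficiently small Cλ_{k+1}^{−1/4−δ} ≤ ½λ_k^{−1/4−2δ}"*.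
[cite: Dimock2013BalabanII, §3.11.3 Lemma 3.14 proof (B) eqs. (substandard), (lamp5) L4290–4311 (arXiv:1212.5562v2 TeX)] -/
theorem caseB {C lam L δ : ℝ} (hC : 0 ≤ C) (hlam : 0 < lam) (hL : 1 ≤ L) (hδ : 0 ≤ δ)
    (hsmall : 2 * C * lam ^ δ ≤ 1) (h : LocalFieldBounds n' (C * (L * lam) ^ (-(1 / 4 + δ))) 1 U₀ U₁ Ψ φmin) :
    PDomain n' (1 / 2) lam (2 * δ) U₀ U₁ Ψ φmin :=
  lfb_mono zero_le_one h (caseB_arith hC hlam hL hδ hsmall)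

/-- **CASE (C)** (L4313–4320: *"□ ⊂ Ω^♮_k − Ω_{k+1}. Argue as in the previous case"*): here the unit field is `Φ_k`, bounded
by `2λ_k^{−1/4−δ}` ((somewhat), first line), so the class reached is `Cλ_k^{−1/4−δ}` at the level-`k` coupling; it lies in
`½𝒫_k(□, 2δ)` under `2Cλ_k^δ ≤ 1` (the print displays the target (lamp6) with `½λ_{k+1}^{−1/4−2δ}`, stronger than the
`½λ_k^{−1/4−2δ}` that the lemma's conclusion `½𝒫_k(□, 2δ)` asks; this module proves the latter).
[cite: Dimock2013BalabanII, §3.11.3 Lemma 3.14 proof (C) eq. (lamp6) L4313–4320 (arXiv:1212.5562v2 TeX)] -/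
theorem caseC {C lam δ : ℝ} (hC : 0 ≤ C) (hlam : 0 < lam) (hδ : 0 ≤ δ) (hsmall : 2 * C * lam ^ δ ≤ 1)
    (h : LocalFieldBounds n' (C * lam ^ (-(1 / 4 + δ))) 1 U₀ U₁ Ψ φmin) :
    PDomain n' (1 / 2) lam (2 * δ) U₀ U₁ Ψ φmin := by
  have h1 := caseB_arith hC hlam le_rfl hδ hsmall
  rw [one_mul] at h1
  exact lfb_mono zero_le_one h h1

omit [NormedSpace ℝ E] in
/-- a sup bound on a unit field bounds its unit derivative by twice as much (used tacitly in (lamp5): only the sup bound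
(substandard) on `Ψ` is invoked before LEMMA 3.1 (2)'s mechanism).
[cite: Dimock2013BalabanII, §3.11.3 Lemma 3.14 proof (B) L4303–4309 (arXiv:1212.5562v2 TeX)] -/
theorem norm_fdUnitV_le_two_mul {B : ℝ} {Sbig : Finset (X d)} {F : X d → E} (hsup : ∀ u ∈ Sbig, ‖F u‖ ≤ B) {μ : Fin d}
    {u : X d} (hu : u ∈ Sbig) (hue : u + e μ ∈ Sbig) : ‖fdUnitV μ F u‖ ≤ 2 * B := by
  rw [fdUnitV, two_mul]
  exact (norm_sub_le _ _).trans (add_le_add (hsup _ hue) (hsup _ hu))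

/-- **CASE (B) FROM ITS PRINTED INPUTS** (L4293–4310): the sup bound (substandard) `‖Ψ_{k,Ω_{k+1}}(Ω′)‖ ≤ C′λ_{k+1}^{−1/4−δ}` on
`□^{∼(2R+1)} ∩ Ω_{k+1}` (*"this is included in the LM enlargement in (substandard), assuming L > 2R+1"*) and LEMMA 3.1 (2)'s
mechanism in the hypothesis shape `converse` (sup bounds `q′` on the field and its unit derivative on `Sbig` ⟹ the pair
`(Ψ, φ^{min}_{k,Ω(□)}(Ψ))` is in the class `C₁q′`; *"we take a more direct approach"*) give (lamp5) with `C = 2C₁C′` and then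
`½𝒫_k(□, 2δ)` under `2·(2C₁C′)·λ_k^δ ≤ 1`.
[cite: Dimock2013BalabanII, §3.11.3 Lemma 3.14 proof (B) L4290–4311 (arXiv:1212.5562v2 TeX)] -/
theorem caseB_chain {C₁ C' lam L δ : ℝ} {Sbig : Finset (X d)} {bg : (X d → E) → X d → E} (hC₁ : 0 ≤ C₁)
    (hC' : 0 ≤ C') (hlam : 0 < lam) (hL : 1 ≤ L) (hδ : 0 ≤ δ)
    (hsmall : 2 * (2 * C₁ * C') * lam ^ δ ≤ 1)
    (converse : ∀ q' : ℝ, ∀ F : X d → E, (∀ u ∈ Sbig, ‖F u‖ ≤ q') →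
      (∀ μ : Fin d, ∀ u ∈ Sbig, u + e μ ∈ Sbig → ‖fdUnitV μ F u‖ ≤ q') →
        LocalFieldBounds n' (C₁ * q') 1 U₀ U₁ F (bg F))
    (hsup : ∀ u ∈ Sbig, ‖Ψ u‖ ≤ C' * (L * lam) ^ (-(1 / 4 + δ))) :
    PDomain n' (1 / 2) lam (2 * δ) U₀ U₁ Ψ (bg Ψ) := by
  have hq0 : 0 ≤ C' * (L * lam) ^ (-(1 / 4 + δ)) :=
    mul_nonneg hC' (Real.rpow_pos_of_pos (mul_pos (by linarith) hlam) _).le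
  have hsup2 : ∀ u ∈ Sbig, ‖Ψ u‖ ≤ 2 * (C' * (L * lam) ^ (-(1 / 4 + δ))) := fun u hu =>
    (hsup u hu).trans (by linarith [hsup u hu, norm_nonneg (Ψ u)])
  have h5 := converse _ Ψ hsup2 (fun μ u hu hue => norm_fdUnitV_le_two_mul hsup hu hue)
  have e1 : C₁ * (2 * (C' * (L * lam) ^ (-(1 / 4 + δ)))) = (2 * C₁ * C') * (L * lam) ^ (-(1 / 4 + δ)) := by ring
  rw [e1] at h5
  exact caseB (by positivity) hlam hL hδ hsmall h5

end CaseB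

section Assembly

variable {ι : Type*} {n' : ℕ}

/-- **LEMMA 3.14 `\label{technical}` ASSEMBLED** (L4188–4198 with the proof's case split L4224–4226, L4231, L4293, L4313):
*"For an M-cube □ ⊂ Ω^♮_k, we must show that (Φ_{k,δΩ_k}, Ψ^{loc}_{k,Ω_{k+1}}(Ω′)) ∈ ½𝒫_k(□, 2δ). We distinguish several
cases. (A.) □ ⊂ Ω^♮_{k+1} … (B.) □ ⊂ Ω_{k+1} − Ω^♮_{k+1} … (C.) □ ⊂ Ω^♮_k − Ω_{k+1}"*.  The cubes of `Ω^♮_k` are an index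
set covered by the three regions; the unit field `F` is the glued pair (`Φ_k` off `Ω_{k+1}`, `Ψ^{loc}` on `Ω_{k+1}`), cube `i`
carries `S₀ i`, `S i` and the fine field `φ^{min}_{k,Ω(□_i)}`; the per-case inputs are the classes reached in cases (A)
(`4λ_{k+1}^{−1/4−2δ}L^{−1/2}`, from (lamp1) + (note9) + (note8) + the `Ψ ↦ Ψ^{loc}` step), (B) (`C_Bλ_{k+1}^{−1/4−δ}`, the
shape (lamp5)) and (C) (`C_Cλ_k^{−1/4−δ}`, from (somewhat)'s first line); conclusion: `(F, φ^{min}) ∈ ½𝒫_k(Ω^♮_k, 2δ)`.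
[cite: Dimock2013BalabanII, §3.11.3 Lemma 3.14 (technical) L4188–4198 with proof L4224–4322 (arXiv:1212.5562v2 TeX)] -/
theorem lemma314_technical {cubes RA RB RC : Finset ι} {S₀ S : ι → Finset (X d)} {F : X d → E}
    {φmin : ι → X d → E} {lam L δ CB CC : ℝ} (hlam : 0 < lam) (hL : 1 ≤ L) (hδ : 0 ≤ δ)
    (hbig : 8 ≤ L ^ (3 / 4 + 2 * δ)) (hCB : 0 ≤ CB) (hCC : 0 ≤ CC)
    (hsmallB : 2 * CB * lam ^ δ ≤ 1) (hsmallC : 2 * CC * lam ^ δ ≤ 1)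
    (hcover : ∀ i ∈ cubes, i ∈ RA ∨ i ∈ RB ∨ i ∈ RC)
    (hA : ∀ i ∈ RA,
      LocalFieldBounds n' (4 * ((L * lam) ^ (-(1 / 4 + 2 * δ)) * L ^ (-(1 / 2 : ℝ)))) 1 (S₀ i) (S i) F (φmin i))
    (hB : ∀ i ∈ RB, LocalFieldBounds n' (CB * (L * lam) ^ (-(1 / 4 + δ))) 1 (S₀ i) (S i) F (φmin i))
    (hC : ∀ i ∈ RC, LocalFieldBounds n' (CC * lam ^ (-(1 / 4 + δ))) 1 (S₀ i) (S i) F (φmin i)) :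
    PDomainX cubes n' (1 / 2) lam (2 * δ) S₀ S F φmin := by
  intro i hi
  have hL0 : 0 < L := by linarith
  rcases hcover i hi with h | h | h
  · exact caseA hlam hL0 hbig (hA i h)
  · exact caseB hCB hlam hL hδ hsmallB (hB i h)
  · exact caseC hCC hlam hδ hsmallC (hC i h)

end Assembly

/-! ## Part 6. LEMMA 3.9 `singsong2` (2) FROM (1) over `E`: (ding) ⟹ (swish); (skunky2) ⟹ (tiny0) ⟹ (salt); the glued
derivative across cube boundaries — and, at `E = ℂ`, (substandard) of LEMMA 3.14 (B) from the sup bound on `φ⁰_{k+1,Ω′}` -/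

section Swish

variable {m n' : ℕ} {c A B D : ℝ} {T₀ : Finset (X d)} {Φ' φ₀ φ₁ : X d → E}

/-- a fine site of a unit cube whose label is a unit point of the `L`-blocks `T₀` is a fine site of those `L`-blocks
(`blk_L ∘ blk_unit = blk_{L·unit}`, `BlockAveragingComposition.blk_blk`). [folklore] -/
private theorem mem_U_two_level {p : X d} (hp : blk n' p ∈ U m T₀) : p ∈ U (m * n' + m + n') T₀ := by
  rw [mem_U, ← blk_blk]
  exact mem_U.1 hp

/-- **(ding) ⟹ (swish), THE FIELD** (L3814–3823: *"The minimizer can be written Ψ_{k,Ω_{k+1}}(Ω′) = Q_kφ⁰_{k+1,Ω′} + (aL^{−2}∕(a_k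
+ aL^{−2}))Q^T(Φ_{k+1} − Q_{k+1}φ⁰_{k+1,Ω′})  (ding)  We claim that on □̃ ∩ Ω_{k+1}  |Ψ_{k,Ω_{k+1}}(Ω′)| ≤ Cp_kα_k^{−1} … These
follow more or less directly from the bounds (not1)"*): `‖φ⁰‖ ≤ A` on the fine sites of the unit cubes labelled by the
unit points of the `L`-blocks `T₀` and `‖Φ_{k+1} − Q_{k+1}φ⁰‖ ≤ D` on `T₀` give `‖Ψ‖ ≤ A + cD` on those unit points
((swish) with `A = Cp_kα_k^{−1}`, `D = Cp_k`; at `E = ℂ` it is (substandard) of LEMMA 3.14 (B), L4293–4298, with `A =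
Cλ_{k+1}^{−1/4−δ}`).
[cite: Dimock2013BalabanII, §3.11.1 Lemma 3.9 (singsong2) eqs. (ding), (swish) L3757–3759, L3814–3823; §3.11.3 (substandard) L4293–4298 (arXiv:1212.5562v2 TeX)] -/
theorem norm_psiOfV_le (hc0 : 0 ≤ c) (hφ : ∀ x ∈ U n' (U m T₀), ‖φ₀ x‖ ≤ A)
    (hD : ∀ u ∈ T₀, ‖Φ' u - qavgV (m * n' + m + n') φ₀ u‖ ≤ D) {y : X d} (hy : y ∈ U m T₀) :
    ‖psiOfV m n' c Φ' φ₀ y‖ ≤ A + c * D := by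
  have h1 : ‖qavgV n' φ₀ y‖ ≤ A :=
    norm_qavgV_le fun p hp => hφ p (mem_U.2 (by rw [mem_B.1 hp]; exact hy))
  have h2 : ‖c • (Φ' (blk m y) - qavgV (m * n' + m + n') φ₀ (blk m y))‖ ≤ c * D := by
    rw [norm_smul, Real.norm_of_nonneg hc0]
    exact mul_le_mul_of_nonneg_left (hD _ (mem_U.1 hy)) hc0
  exact (norm_add_le _ _).trans (add_le_add h1 h2)

/-- **(ding) ⟹ (swish), THE DERIVATIVE** (L3821–3823: *"The bound |Q^T(Φ_{k+1} − Q_{k+1}φ⁰_{k+1,Ω′})| ≤ Cp_k, implies a bound of the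
same form on the derivative, since it is defined on a unit lattice"*): `‖∂φ⁰‖ ≤ B` on the fine bonds and `‖Φ_{k+1} −
Q_{k+1}φ⁰‖ ≤ D` on `T₀` give `‖∂Ψ‖ ≤ B + 2cD` on the unit bonds (the block-average difference is at most `B` by AVERAGING FACT
2; the `Q^T`-term changes by at most `2D`). [cite: Dimock2013BalabanII, §3.11.1 Lemma 3.9 (singsong2) eq. (swish) L3757–3759, proof L3819–3823 (arXiv:1212.5562v2 TeX)] -/
theorem norm_fdUnitV_psiOfV_le (hc0 : 0 ≤ c)
    (hdφ : ∀ μ : Fin d, ∀ x ∈ U n' (U m T₀), x + e μ ∈ U n' (U m T₀) → ‖fdFineV n' μ φ₀ x‖ ≤ B)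
    (hD : ∀ u ∈ T₀, ‖Φ' u - qavgV (m * n' + m + n') φ₀ u‖ ≤ D) {μ : Fin d} {y : X d} (hy : y ∈ U m T₀)
    (hye : y + e μ ∈ U m T₀) : ‖fdUnitV μ (psiOfV m n' c Φ' φ₀) y‖ ≤ B + c * (2 * D) := by
  have hn : (0 : ℝ) < (n' : ℝ) + 1 := by positivity
  -- the block-average part
  have hQ : ‖qavgV n' φ₀ (y + e μ) - qavgV n' φ₀ y‖ ≤ ((n' : ℝ) + 1) * (B / ((n' : ℝ) + 1)) := by
    refine norm_qavgV_sub_le fun p hp t ht => ?_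
    have hpy : blk n' p = y := mem_B.1 hp
    have hx : p + (t : ℤ) • e μ ∈ U n' (U m T₀) :=
      add_steps_mem_U (by rw [hpy]; exact hy) (by rw [hpy]; exact hye) ht.le
    have hxe : p + (t : ℤ) • e μ + e μ ∈ U n' (U m T₀) := by
      have h2 : p + (t : ℤ) • e μ + e μ = p + ((t + 1 : ℕ) : ℤ) • e μ := by
        rw [Nat.cast_succ, add_smul, one_smul, add_assoc]
      rw [h2]
      exact add_steps_mem_U (by rw [hpy]; exact hy) (by rw [hpy]; exact hye) (by omega)
    have hb := hdφ μ _ hx hxe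
    rw [fdFineV, norm_smul, Real.norm_of_nonneg hn.le] at hb
    rw [le_div_iff₀ hn, mul_comm]
    exact hb
  rw [mul_div_cancel₀ _ hn.ne'] at hQ
  -- the `Q^T`-part
  have hX : ‖c • (Φ' (blk m (y + e μ)) - qavgV (m * n' + m + n') φ₀ (blk m (y + e μ)))
      - c • (Φ' (blk m y) - qavgV (m * n' + m + n') φ₀ (blk m y))‖ ≤ c * (2 * D) := by
    rw [← smul_sub, norm_smul, Real.norm_of_nonneg hc0]
    refine mul_le_mul_of_nonneg_left ?_ hc0
    rw [two_mul]
    exact (norm_sub_le _ _).trans (add_le_add (hD _ (mem_U.1 hye)) (hD _ (mem_U.1 hy)))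
  have e1 : fdUnitV μ (psiOfV m n' c Φ' φ₀) y = (qavgV n' φ₀ (y + e μ) - qavgV n' φ₀ y)
      + (c • (Φ' (blk m (y + e μ)) - qavgV (m * n' + m + n') φ₀ (blk m (y + e μ)))
        - c • (Φ' (blk m y) - qavgV (m * n' + m + n') φ₀ (blk m y))) := by
    simp only [fdUnitV, psiOfV]; abel
  rw [e1]
  exact (norm_add_le _ _).trans (add_le_add hQ hX)

/-- **(skunky2) ⟹ (tiny0)** (L3826–3834: *"|Ψ_{k,Ω_{k+1}}(Ω′, □*) − Ψ_{k,Ω_{k+1}}(Ω′)| = |Q_k(φ⁰_{k+1,Ω′}(□*) − φ⁰_{k+1,Ω′}) −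
(aL^{−2}∕(a_k + aL^{−2}))Q^TQ_{k+1}(φ⁰_{k+1,Ω′}(□*) − φ⁰_{k+1,Ω′})| ≤ e^{−r_{k+1}}"*): two `Ψ`'s built by (ding) from the same
`Φ_{k+1}` and fine fields `φ₁`, `φ₀` with `‖φ₁ − φ₀‖ ≤ t` on the fine sites differ by at most `(1 + c)t` (the print absorbs
`1 + c ≤ 2` into (skunky2)'s room). [cite: Dimock2013BalabanII, §3.11.1 Lemma 3.9 (singsong2) eqs. (skunky2) L3751–3754, (tiny0) L3826–3834 (arXiv:1212.5562v2 TeX)] -/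
theorem norm_psiOfV_sub_psiOfV_le (hc0 : 0 ≤ c) {t : ℝ}
    (hδ : ∀ x ∈ U (m * n' + m + n') T₀, ‖(φ₁ - φ₀) x‖ ≤ t) {y : X d} (hy : y ∈ U m T₀) :
    ‖psiOfV m n' c Φ' φ₁ y - psiOfV m n' c Φ' φ₀ y‖ ≤ (1 + c) * t := by
  have h1 : ‖qavgV n' (φ₁ - φ₀) y‖ ≤ t :=
    norm_qavgV_le fun p hp => hδ p (mem_U_two_level (by rw [mem_B.1 hp]; exact hy))
  have h2 : ‖qavgV (m * n' + m + n') (φ₁ - φ₀) (blk m y)‖ ≤ t :=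
    norm_qavgV_le fun p hp => hδ p (mem_U.2 (by rw [mem_B.1 hp]; exact mem_U.1 hy))
  have e1 : psiOfV m n' c Φ' φ₁ y - psiOfV m n' c Φ' φ₀ y
      = qavgV n' (φ₁ - φ₀) y - c • qavgV (m * n' + m + n') (φ₁ - φ₀) (blk m y) := by
    simp only [psiOfV, qavgV_sub, smul_sub]; abel
  rw [e1]
  calc ‖qavgV n' (φ₁ - φ₀) y - c • qavgV (m * n' + m + n') (φ₁ - φ₀) (blk m y)‖
      ≤ ‖qavgV n' (φ₁ - φ₀) y‖ + ‖c • qavgV (m * n' + m + n') (φ₁ - φ₀) (blk m y)‖ := norm_sub_le _ _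
    _ ≤ t + c * t := by
        rw [norm_smul, Real.norm_of_nonneg hc0]
        exact add_le_add h1 (mul_le_mul_of_nonneg_left h2 hc0)
    _ = (1 + c) * t := by ring

end Swish

section Salt

variable {ι : Type*} {s B' : ℝ}

omit [NormedSpace ℝ E] in
/-- **(tiny0) ⟹ (salt) FOR THE SHARPLY LOCALIZED FIELD** (L3835: *"This implies the bound on Ψ^{loc}_{k,Ω_{k+1}}(Ω′) −
Ψ_{k,Ω_{k+1}}(Ω′)"*): `Ψ^{loc}` agrees on the points of cube `i` with the cube's field `Ψ(Ω′, □_i*)`, each within `s` of `Ψ`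
there; hence `‖Ψ^{loc} − Ψ‖ ≤ s` everywhere on the covered points.
[cite: Dimock2013BalabanII, §3.11.1 Lemma 3.9 (singsong2) eq. (salt) L3762–3765 with L3835 (arXiv:1212.5562v2 TeX)] -/
theorem salt_of_tiny0 {pts : ι → Finset (X d)} {Ψloc Ψ : X d → E} {Ψsq : ι → X d → E}
    (hloc : ∀ i, ∀ y ∈ pts i, Ψloc y = Ψsq i y) (htiny : ∀ i, ∀ y ∈ pts i, ‖Ψsq i y - Ψ y‖ ≤ s)
    {i : ι} {y : X d} (hy : y ∈ pts i) : ‖Ψloc y - Ψ y‖ ≤ s := by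
  rw [hloc i y hy]
  exact htiny i y hy

omit [NormedSpace ℝ E] in
/-- **THE DERIVATIVE OF `Ψ^{loc}` ACROSS A CUBE BOUNDARY** (L3837–3845: *"Suppose □₁, □₂ are adjacent cubes and x ∈ □₁ ∩
Ω^{(k)}_{k+1} and x + e_μ ∈ □₂ ∩ Ω^{(k)}_{k+1}. We need to show |Ψ(Ω′, □₂*, x + e_μ) − Ψ(Ω′, □₁*, x)| ≤ Cp_k. However just as in
(tiny0) one can show |Ψ(Ω′, □₁*, x) − Ψ(Ω′, □₂*, x)| ≤ e^{−r_{k+1}}. This reduces the estimate to |∂Ψ(Ω′, □₂*, x)| ≤ Cp_k"*):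
`‖Ψ₂(x + e_μ) − Ψ₁(x)‖ ≤ ‖∂Ψ₂(x)‖ + ‖Ψ₂(x) − Ψ₁(x)‖ ≤ B′ + s`.
[cite: Dimock2013BalabanII, §3.11.1 Lemma 3.9 (singsong2) proof L3837–3845 (arXiv:1212.5562v2 TeX)] -/
theorem norm_fdUnitV_glued_le {Ψ₁ Ψ₂ Ψloc : X d → E} {μ : Fin d} {x : X d} (h₁ : Ψloc x = Ψ₁ x)
    (h₂ : Ψloc (x + e μ) = Ψ₂ (x + e μ)) (hd : ‖fdUnitV μ Ψ₂ x‖ ≤ B') (hs : ‖Ψ₂ x - Ψ₁ x‖ ≤ s) :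
    ‖fdUnitV μ Ψloc x‖ ≤ B' + s := by
  have e1 : fdUnitV μ Ψloc x = fdUnitV μ Ψ₂ x + (Ψ₂ x - Ψ₁ x) := by
    simp only [fdUnitV, h₁, h₂]; abel
  rw [e1]
  exact (norm_add_le _ _).trans (add_le_add hd hs)

end Salt

/-! ## Part 7. The fine-field analyticity domain `ℛ_k(X, ε)` (part I §3.2 ∕ part II DEFINITION (rk)) over `E`, with the
lattice Hölder quotient `δ_α`; part I LEMMA `strong` (2) «φ_k ∈ ℛ_k» ASSEMBLED from (gk2) with the PRINTED smallness
`p_k ≤ p!(2∕ε)^p λ_k^{−ε∕2} ≤ λ_k^{−ε}`; part II's `½ℛ_k` memberships from (dos)-type bounds (Lemma 3.15 Remark 2) -/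

section RDomain

variable {n : ℕ} {S : Finset (X d)} {φ : X d → E}

/-- **DEFINITION (rk) (part II L2302–2314; part I §3.2 L1230–1239), SCALED: `cℛ_k(X, ε)`** = all `E`-valued (print:
complex-valued) fine fields on the fine sites of the cubes `S` with `‖φ‖ < cλ_k^{−1/4−3ε}`, `‖∂φ‖ < cλ_k^{−1/4−2ε}` on the fine bonds,
and the HÖLDER bound `‖δ_α∂φ‖ < cλ_k^{−1/4−ε}`, `(δ_αf)(x,x′) = (f(x) − f(x′))∕d(x,x′)^α` for `d(x,x′) ≤ 1` (part I L922–927), written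
multiplicatively: `‖∂_μφ(x) − ∂_μφ(x′)‖ < cλ_k^{−1/4−ε}·d(x,x′)^α` for fine sites `x ≠ x′` at sup-distance `≤ n+1` lattice steps
(`d(x,x′) = dist x x′∕(n+1) ≤ 1` in units where the block side `n + 1 = L^k` is `1`); `c = 1` the domain, `c = ½` the `½ℛ_k` of
LEMMA 3.15's proof.
[cite: Dimock2013BalabanII, §3.2 Definition (rk) L2302–2314; Dimock2013 part I §3.2 L1230–1239 and L922–927 (arXiv:1212.5562v2 ∕ 1108.1335v2 TeX)] -/
def RDomain (n : ℕ) (c lam ε αH : ℝ) (S : Finset (X d)) (φ : X d → E) : Prop :=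
  (∀ x ∈ U n S, ‖φ x‖ < c * lam ^ (-(1 / 4 + 3 * ε))) ∧
    (∀ μ : Fin d, ∀ x ∈ U n S, x + e μ ∈ U n S → ‖fdFineV n μ φ x‖ < c * lam ^ (-(1 / 4 + 2 * ε))) ∧
      (∀ μ : Fin d, ∀ x ∈ U n S, ∀ x' ∈ U n S, x + e μ ∈ U n S → x' + e μ ∈ U n S → x ≠ x' →
        dist x x' ≤ (n : ℝ) + 1 →
          ‖fdFineV n μ φ x - fdFineV n μ φ x'‖ < c * lam ^ (-(1 / 4 + ε)) * (dist x x' / ((n : ℝ) + 1)) ^ αH)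

/-- for `0 < λ ≤ 1` the three thresholds are ordered: `λ^{−(1/4+ε)} ≤ λ^{−(1/4+2ε)} ≤ λ^{−(1/4+3ε)}` (`ε ≥ 0`) — *"We would also
like bounds on φ, ∂φ, δ_α∂φ to be all about the same size, however it is convenient to allow a little deviation"* (part I
L1227–1228). [cite: Dimock2013, part I §3.2 L1227–1239 (arXiv:1108.1335v2 TeX)] -/
theorem rpow_thresholds_mono {lam ε : ℝ} (hlam : 0 < lam) (hlam1 : lam ≤ 1) (hε : 0 ≤ ε) :
    lam ^ (-(1 / 4 + ε)) ≤ lam ^ (-(1 / 4 + 2 * ε)) ∧ lam ^ (-(1 / 4 + 2 * ε)) ≤ lam ^ (-(1 / 4 + 3 * ε)) :=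
  ⟨Real.rpow_le_rpow_of_exponent_ge hlam hlam1 (by linarith),
    Real.rpow_le_rpow_of_exponent_ge hlam hlam1 (by linarith)⟩

/-- **PART I LEMMA `strong` (2) «for λ_k sufficiently small φ_k = a_kG_kQ_k^TΦ_k ∈ ℛ_k», ASSEMBLED** (part I L1245–1248 with proof
L1266–1281: *"The bounds on φ_k, ∂φ_k follow directly. Furthermore by (gk2) and ‖Q_k^TΦ_k‖_∞ ≤ ‖Φ_k‖_∞ and p_k ≤ 𝒪(1)λ_k^{−ε∕2}
|δ_α∂φ_k| = |a_kδ_α∂G_kQ_k^TΦ_k| ≤ C‖Φ_k‖_∞ ≤ Cp_kλ_k^{−1/4} ≤ λ_k^{−1/4−ε}"*): the kernel bounds (gk2) in the hypothesis shape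
`‖φ_k‖, ‖∂φ_k‖ ≤ C·B`, `‖δ_α∂φ_k‖ ≤ C·B·d^α` with `B = ‖Φ_k‖_∞ ≤ 2p_kλ_k^{−1/4}` (LEMMA `strong` (1), the tree's
`SmallFieldBounds.lemmaStrong_abs`) and the smallness `2Cp_k < λ_k^{−ε}` give `φ_k ∈ ℛ_k` (`0 < λ_k ≤ 1`, `ε ≥ 0`).
[cite: Dimock2013, part I §3.2 Lemma strong (2) L1245–1248, proof L1266–1281 (arXiv:1108.1335v2 TeX)] -/
theorem lemmaStrong_two {C B pk lam ε αH : ℝ} (hlam : 0 < lam) (hlam1 : lam ≤ 1) (hε : 0 ≤ ε) (hC : 0 ≤ C)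
    (hB : B ≤ 2 * pk * lam ^ (-(1 / 4 : ℝ))) (hsmall : 2 * C * pk < lam ^ (-ε))
    (hsup : ∀ x ∈ U n S, ‖φ x‖ ≤ C * B)
    (hder : ∀ μ : Fin d, ∀ x ∈ U n S, x + e μ ∈ U n S → ‖fdFineV n μ φ x‖ ≤ C * B)
    (hH : ∀ μ : Fin d, ∀ x ∈ U n S, ∀ x' ∈ U n S, x + e μ ∈ U n S → x' + e μ ∈ U n S → x ≠ x' →
      dist x x' ≤ (n : ℝ) + 1 →
        ‖fdFineV n μ φ x - fdFineV n μ φ x'‖ ≤ C * B * (dist x x' / ((n : ℝ) + 1)) ^ αH) :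
    RDomain n 1 lam ε αH S φ := by
  have hq : 0 < lam ^ (-(1 / 4 : ℝ)) := Real.rpow_pos_of_pos hlam _
  -- `C·B ≤ 2Cp_kλ^{−1/4} < λ^{−ε}λ^{−1/4} = λ^{−(1/4+ε)}`
  have hCB : C * B < lam ^ (-(1 / 4 + ε)) := by
    have h1 : C * B ≤ (2 * C * pk) * lam ^ (-(1 / 4 : ℝ)) := by nlinarith [mul_le_mul_of_nonneg_left hB hC]
    have h2 : (2 * C * pk) * lam ^ (-(1 / 4 : ℝ)) < lam ^ (-ε) * lam ^ (-(1 / 4 : ℝ)) :=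
      mul_lt_mul_of_pos_right hsmall hq
    have h3 : lam ^ (-ε) * lam ^ (-(1 / 4 : ℝ)) = lam ^ (-(1 / 4 + ε)) := by
      rw [← Real.rpow_add hlam]; congr 1; ring
    linarith [h3 ▸ h2]
  have hmono := rpow_thresholds_mono hlam hlam1 hε
  refine ⟨fun x hx => ?_, fun μ x hx hxe => ?_, fun μ x hx x' hx' hxe hxe' hne hdist => ?_⟩
  · rw [one_mul]; exact (hsup x hx).trans_lt (hCB.trans_le (hmono.1.trans hmono.2))
  · rw [one_mul]; exact (hder μ x hx hxe).trans_lt (hCB.trans_le hmono.1)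
  · rw [one_mul]
    have hρ : 0 < (dist x x' / ((n : ℝ) + 1)) ^ αH :=
      Real.rpow_pos_of_pos (div_pos (dist_pos.2 hne) (by positivity)) _
    exact (hH μ x hx x' hx' hxe hxe' hne hdist).trans_lt (mul_lt_mul_of_pos_right hCB hρ)

/-- **THE PRINTED SMALLNESS STEP** (part I L1268–1272: *"if λ_k is small we have p_k ≤ λ_k^{−ε} since p_k = (−log λ_k)^p ≤ p!(2∕ε)^p
e^{½ε(−log λ_k)} = p!(2∕ε)^p λ_k^{−ε∕2} ≤ λ_k^{−ε}"*): the first inequality, from `y^p∕p! ≤ e^y` at `y = ½ε(−log λ_k)`.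
[cite: Dimock2013, part I §3.2 Lemma strong proof L1268–1272 (arXiv:1108.1335v2 TeX)] -/
theorem log_pow_le_factorial_rpow {lam ε : ℝ} (p : ℕ) (hε : 0 < ε) (hlam : 0 < lam) (hlam1 : lam ≤ 1) :
    (-Real.log lam) ^ p ≤ (Nat.factorial p : ℝ) * (2 / ε) ^ p * lam ^ (-(ε / 2)) := by
  set x := -Real.log lam with hx
  have hx0 : 0 ≤ x := by rw [hx]; exact neg_nonneg.2 (Real.log_nonpos hlam.le hlam1)
  have hy : 0 ≤ ε / 2 * x := by positivity
  have hfac : 0 < (Nat.factorial p : ℝ) := by exact_mod_cast Nat.factorial_pos p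
  have h1 : (ε / 2 * x) ^ p / (Nat.factorial p : ℝ) ≤ Real.exp (ε / 2 * x) := Real.pow_div_factorial_le_exp _ hy p
  have h2 : (ε / 2 * x) ^ p ≤ (Nat.factorial p : ℝ) * Real.exp (ε / 2 * x) := by
    rw [mul_comm ((Nat.factorial p : ℝ))]
    exact (div_le_iff₀ hfac).1 h1
  have hexp : Real.exp (ε / 2 * x) = lam ^ (-(ε / 2)) := by
    rw [Real.rpow_def_of_pos hlam, hx]; congr 1; ring
  have hε2 : 0 < (2 / ε) ^ p := pow_pos (by positivity) p
  calc x ^ p = (2 / ε) ^ p * (ε / 2 * x) ^ p := by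
        rw [← mul_pow]; congr 1; field_simp
    _ ≤ (2 / ε) ^ p * ((Nat.factorial p : ℝ) * Real.exp (ε / 2 * x)) := mul_le_mul_of_nonneg_left h2 hε2.le
    _ = (Nat.factorial p : ℝ) * (2 / ε) ^ p * lam ^ (-(ε / 2)) := by rw [hexp]; ring

/-- … and the second: `p!(2∕ε)^p λ_k^{−ε∕2} ≤ λ_k^{−ε}` as soon as `p!(2∕ε)^p ≤ λ_k^{−ε∕2}` (*"if λ_k is small"* made explicit), hence
`p_k = (−log λ_k)^p ≤ λ_k^{−ε}`. [cite: Dimock2013, part I §3.2 Lemma strong proof L1268–1272 (arXiv:1108.1335v2 TeX)] -/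
theorem log_pow_le_rpow_neg_printed {lam ε : ℝ} (p : ℕ) (hε : 0 < ε) (hlam : 0 < lam) (hlam1 : lam ≤ 1)
    (hsmall : (Nat.factorial p : ℝ) * (2 / ε) ^ p ≤ lam ^ (-(ε / 2))) : (-Real.log lam) ^ p ≤ lam ^ (-ε) := by
  have h1 := log_pow_le_factorial_rpow p hε hlam hlam1
  have hh : 0 < lam ^ (-(ε / 2)) := Real.rpow_pos_of_pos hlam _
  have h2 : (Nat.factorial p : ℝ) * (2 / ε) ^ p * lam ^ (-(ε / 2)) ≤ lam ^ (-(ε / 2)) * lam ^ (-(ε / 2)) :=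
    mul_le_mul_of_nonneg_right hsmall hh.le
  have h3 : lam ^ (-(ε / 2)) * lam ^ (-(ε / 2)) = lam ^ (-ε) := by
    rw [← Real.rpow_add hlam]; congr 1; ring
  linarith [h3 ▸ h2]

/-- **`½ℛ_k` FROM (dos)-TYPE BOUNDS** (part II LEMMA 3.15 Remark 2, L4492–4493: *"The bounds (dos) and (somewhat) and 2δ < ε yield
|φ⁰_{k+1,Ω′}| ≤ Cλ_k^{−1/4−2δ} ≤ ½λ_k^{−1/4−3ε} with similar bounds on derivatives. Thus φ⁰_{k+1,Ω′} is in ½ℛ_k as required"*;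
likewise §3.18 L6084–6090 *"since 2δ < ε these are more than sufficient to guarantee that φ_{k+1,Ω′,L} ∈ ½ℛ_k"*): sup bounds
`Cλ_k^{−(1/4+2δ)}` on the field, its derivative and its Hölder quotient put the field in `½ℛ_k(X, ε)` as soon as `2Cλ_k^{ε−2δ} <
1` — possible for small `λ_k` exactly because `2δ < ε` (the binding clause is the Hölder one, threshold `½λ_k^{−1/4−ε}`).
[cite: Dimock2013BalabanII, §3.13 Lemma 3.15 Remark 2 L4492–4493 and §3.18 L6084–6090, with §2.5 (dos) L1598–1601 (arXiv:1212.5562v2 TeX)] -/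
theorem half_rDomain_of_bounds {C lam ε δ αH : ℝ} (hlam : 0 < lam) (hlam1 : lam ≤ 1) (hε : 0 ≤ ε)
    (hsmall : 2 * C * lam ^ (ε - 2 * δ) < 1)
    (hsup : ∀ x ∈ U n S, ‖φ x‖ ≤ C * lam ^ (-(1 / 4 + 2 * δ)))
    (hder : ∀ μ : Fin d, ∀ x ∈ U n S, x + e μ ∈ U n S → ‖fdFineV n μ φ x‖ ≤ C * lam ^ (-(1 / 4 + 2 * δ)))
    (hH : ∀ μ : Fin d, ∀ x ∈ U n S, ∀ x' ∈ U n S, x + e μ ∈ U n S → x' + e μ ∈ U n S → x ≠ x' →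
      dist x x' ≤ (n : ℝ) + 1 →
        ‖fdFineV n μ φ x - fdFineV n μ φ x'‖ ≤ C * lam ^ (-(1 / 4 + 2 * δ)) * (dist x x' / ((n : ℝ) + 1)) ^ αH) :
    RDomain n (1 / 2) lam ε αH S φ := by
  -- `Cλ^{−(1/4+2δ)} = (Cλ^{ε−2δ})·λ^{−(1/4+ε)} < ½λ^{−(1/4+ε)}`
  have hpos : 0 < lam ^ (-(1 / 4 + ε)) := Real.rpow_pos_of_pos hlam _
  have hsplit : C * lam ^ (-(1 / 4 + 2 * δ)) = (C * lam ^ (ε - 2 * δ)) * lam ^ (-(1 / 4 + ε)) := by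
    rw [mul_assoc, ← Real.rpow_add hlam]; congr 2; ring
  have hkey : C * lam ^ (-(1 / 4 + 2 * δ)) < 1 / 2 * lam ^ (-(1 / 4 + ε)) := by
    rw [hsplit]
    exact mul_lt_mul_of_pos_right (by linarith) hpos
  have hmono := rpow_thresholds_mono hlam hlam1 hε
  have hh : (0 : ℝ) ≤ 1 / 2 := by norm_num
  refine ⟨fun x hx => ?_, fun μ x hx hxe => ?_, fun μ x hx x' hx' hxe hxe' hne hdist => ?_⟩
  · exact (hsup x hx).trans_lt (hkey.trans_le (mul_le_mul_of_nonneg_left (hmono.1.trans hmono.2) hh))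
  · exact (hder μ x hx hxe).trans_lt (hkey.trans_le (mul_le_mul_of_nonneg_left hmono.1 hh))
  · have hρ : 0 < (dist x x' / ((n : ℝ) + 1)) ^ αH :=
      Real.rpow_pos_of_pos (div_pos (dist_pos.2 hne) (by positivity)) _
    exact (hH μ x hx x' hx' hxe hxe' hne hdist).trans_lt (mul_lt_mul_of_pos_right hkey hρ)

/-- `cℛ_k ⊆ c′ℛ_k` for `c ≤ c′` (`λ > 0`). [cite: Dimock2013BalabanII, §3.13 Lemma 3.15 proof (A) L4502, L4508–4510 (arXiv:1212.5562v2 TeX)] -/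
theorem rDomain_mono {c c' lam ε αH : ℝ} (hlam : 0 < lam) (h : RDomain n c lam ε αH S φ) (hc : c ≤ c') :
    RDomain n c' lam ε αH S φ := by
  have m1 : ∀ t : ℝ, c * lam ^ t ≤ c' * lam ^ t := fun t =>
    mul_le_mul_of_nonneg_right hc (Real.rpow_pos_of_pos hlam _).le
  refine ⟨fun x hx => (h.1 x hx).trans_le (m1 _), fun μ x hx hxe => (h.2.1 μ x hx hxe).trans_le (m1 _),
    fun μ x hx x' hx' hxe hxe' hne hdist => (h.2.2 μ x hx x' hx' hxe hxe' hne hdist).trans_le ?_⟩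
  exact mul_le_mul_of_nonneg_right (m1 _) (Real.rpow_nonneg (div_nonneg dist_nonneg (by positivity)) _)

/-- the classes add: `c₁ℛ_k + c₂ℛ_k ⊆ (c₁ + c₂)ℛ_k` (the step *"φ ∈ ½ℛ_k … t𝒲_{k,Ω′} ∈ ½ℛ_k. Thus t → E_k(X, φ⁰_{k+1,Ω′} + t𝒲_{k,Ω′}) is
analytic"*, LEMMA 3.15 proof (A) L4508–4511: the sum stays in `ℛ_k`). [cite: Dimock2013BalabanII, §3.13 Lemma 3.15 proof (A) L4508–4511 (arXiv:1212.5562v2 TeX)] -/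
theorem rDomain_add {c₁ c₂ lam ε αH : ℝ} {φ₁ φ₂ : X d → E} (h₁ : RDomain n c₁ lam ε αH S φ₁)
    (h₂ : RDomain n c₂ lam ε αH S φ₂) : RDomain n (c₁ + c₂) lam ε αH S (φ₁ + φ₂) := by
  refine ⟨fun x hx => ?_, fun μ x hx hxe => ?_, fun μ x hx x' hx' hxe hxe' hne hdist => ?_⟩
  · rw [Pi.add_apply, add_mul]
    exact (norm_add_le _ _).trans_lt (add_lt_add (h₁.1 x hx) (h₂.1 x hx))
  · rw [fdFineV_add, add_mul]
    exact (norm_add_le _ _).trans_lt (add_lt_add (h₁.2.1 μ x hx hxe) (h₂.2.1 μ x hx hxe))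
  · have e1 : fdFineV n μ (φ₁ + φ₂) x - fdFineV n μ (φ₁ + φ₂) x'
        = (fdFineV n μ φ₁ x - fdFineV n μ φ₁ x') + (fdFineV n μ φ₂ x - fdFineV n μ φ₂ x') := by
      rw [fdFineV_add, fdFineV_add]; abel
    rw [e1, add_mul, add_mul]
    exact (norm_add_le _ _).trans_lt
      (add_lt_add (h₁.2.2 μ x hx x' hx' hxe hxe' hne hdist) (h₂.2.2 μ x hx x' hx' hxe hxe' hne hdist))

end RDomain

/-! ## Part 8. Uniform bounds ⟹ `cℛ_k` (part I LEMMA 16 «𝒲_k ∈ λ_k^{1/4}ℛ_k»); complex multiples in `ℛ_k` and the analyticity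
disc of LEMMA 3.15 (A): `t𝒲_{k,Ω′} ∈ ½ℛ_k` for `|t| ≤ λ_k^{−1/4}`, hence `φ⁰_{k+1,Ω′} + t𝒲_{k,Ω′} ∈ ℛ_k` on the whole disc (the
domain statement behind *"t → E_k(X, φ⁰ + t𝒲) is analytic in |t| ≤ λ_k^{−1/4}"*) -/

section UniformBound

variable {n : ℕ} {S : Finset (X d)} {φ : X d → E}

/-- **UNIFORM BOUNDS ⟹ `cℛ_k`**: `‖φ‖, ‖∂φ‖ ≤ B` and `‖δ_α∂φ‖ ≤ B·d^α` with `B < cλ_k^{−(1/4+ε)}` (the Hölder threshold, the smallest of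
the three for `λ_k ≤ 1`) put `φ` in `cℛ_k(X, ε)` — the common shape of part I LEMMA `strong` (2), part I LEMMA 16's last clause and
part II's `½ℛ_k` remarks. [cite: Dimock2013, part I §4.3 Lemma 16 (label 11) proof L2209–2215 (arXiv:1108.1335v2 TeX)] -/
theorem rDomain_of_uniform_bound {B c lam ε αH : ℝ} (hlam : 0 < lam) (hlam1 : lam ≤ 1) (hε : 0 ≤ ε)
    (hB : B < c * lam ^ (-(1 / 4 + ε))) (hsup : ∀ x ∈ U n S, ‖φ x‖ ≤ B)
    (hder : ∀ μ : Fin d, ∀ x ∈ U n S, x + e μ ∈ U n S → ‖fdFineV n μ φ x‖ ≤ B)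
    (hH : ∀ μ : Fin d, ∀ x ∈ U n S, ∀ x' ∈ U n S, x + e μ ∈ U n S → x' + e μ ∈ U n S → x ≠ x' →
      dist x x' ≤ (n : ℝ) + 1 → ‖fdFineV n μ φ x - fdFineV n μ φ x'‖ ≤ B * (dist x x' / ((n : ℝ) + 1)) ^ αH) :
    RDomain n c lam ε αH S φ := by
  have hmono := rpow_thresholds_mono hlam hlam1 hε
  -- at any fine site the hypotheses force `c ≥ 0` (the predicate is vacuous when there are none)
  have hc_of : ∀ x ∈ U n S, 0 ≤ c := by
    intro x hx
    have hp : 0 < lam ^ (-(1 / 4 + ε)) := Real.rpow_pos_of_pos hlam _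
    have h0 : 0 < c * lam ^ (-(1 / 4 + ε)) := ((norm_nonneg (φ x)).trans (hsup x hx)).trans_lt hB
    by_contra hneg
    have h1 : c * lam ^ (-(1 / 4 + ε)) < 0 := mul_neg_of_neg_of_pos (not_le.1 hneg) hp
    linarith
  refine ⟨fun x hx => ?_, fun μ x hx hxe => ?_, fun μ x hx x' hx' hxe hxe' hne hdist => ?_⟩
  · exact (hsup x hx).trans_lt (hB.trans_le (mul_le_mul_of_nonneg_left (hmono.1.trans hmono.2) (hc_of x hx)))
  · exact (hder μ x hx hxe).trans_lt (hB.trans_le (mul_le_mul_of_nonneg_left hmono.1 (hc_of x hx)))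
  · have hρ : 0 < (dist x x' / ((n : ℝ) + 1)) ^ αH :=
      Real.rpow_pos_of_pos (div_pos (dist_pos.2 hne) (by positivity)) _
    exact (hH μ x hx x' hx' hxe hxe' hne hdist).trans_lt (mul_lt_mul_of_pos_right hB hρ)

/-- **PART I LEMMA 16 (`\label{11}`), LAST CLAUSE «Furthermore 𝒲_k ∈ λ_k^{1/4}ℛ_k», ASSEMBLED** (part I L2187–2193 with proof
L2209–2215: *"|𝒲_k| = |a_kG_kQ_k^TC_k^{1/2}W| ≤ C‖C_k^{1/2}W‖_∞ ≤ Cp_{0,k} ≤ p_k ≤ λ_k^{−ε} ≤ λ_k^{−3ε}  The last bound is the one needed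
for 𝒲_k ∈ λ_k^{1/4}ℛ_k. The bounds on ∂𝒲_k and δ_α∂𝒲_k are similar"*): the (wbounds) `‖𝒲_k‖, ‖∂𝒲_k‖ ≤ Cp_{0,k}`, `‖δ_α∂𝒲_k‖ ≤
Cp_{0,k}·d^α` (hypothesis shape; their kernel inputs are `CovarianceSquareRoot` §§5–6 and (gk2)) and the smallness `Cp_{0,k} < λ_k^{−ε}`
give `𝒲_k ∈ λ_k^{1/4}ℛ_k` (scaling constant `c = λ_k^{1/4}`: `λ^{1/4}·λ^{−(1/4+ε)} = λ^{−ε}`).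
[cite: Dimock2013, part I §4.3 Lemma 16 (label 11) L2187–2193, proof L2209–2215 (arXiv:1108.1335v2 TeX)] -/
theorem calW_mem_rDomain {C p0k lam ε αH : ℝ} {W : X d → E} (hlam : 0 < lam) (hlam1 : lam ≤ 1) (hε : 0 ≤ ε)
    (hsmall : C * p0k < lam ^ (-ε)) (hsup : ∀ x ∈ U n S, ‖W x‖ ≤ C * p0k)
    (hder : ∀ μ : Fin d, ∀ x ∈ U n S, x + e μ ∈ U n S → ‖fdFineV n μ W x‖ ≤ C * p0k)
    (hH : ∀ μ : Fin d, ∀ x ∈ U n S, ∀ x' ∈ U n S, x + e μ ∈ U n S → x' + e μ ∈ U n S → x ≠ x' →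
      dist x x' ≤ (n : ℝ) + 1 →
        ‖fdFineV n μ W x - fdFineV n μ W x'‖ ≤ C * p0k * (dist x x' / ((n : ℝ) + 1)) ^ αH) :
    RDomain n (lam ^ (1 / 4 : ℝ)) lam ε αH S W := by
  refine rDomain_of_uniform_bound hlam hlam1 hε ?_ hsup hder hH
  have h1 : lam ^ (1 / 4 : ℝ) * lam ^ (-(1 / 4 + ε)) = lam ^ (-ε) := by
    rw [← Real.rpow_add hlam]; congr 1; ring
  rw [h1]
  exact hsmall

end UniformBound

section Disc

variable {n : ℕ} {S : Finset (X d)}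

/-- the fine derivative commutes with a complex constant factor. [cite: Dimock2013BalabanII, §3.13 Lemma 3.15 proof (A) L4505–4511 (arXiv:1212.5562v2 TeX)] -/
theorem fdFineV_const_mul (n : ℕ) (μ : Fin d) (t : ℂ) (W : X d → ℂ) (x : X d) :
    fdFineV n μ (fun y => t * W y) x = t * fdFineV n μ W x := by
  simp only [fdFineV, Complex.real_smul]
  ring

/-- **A COMPLEX MULTIPLE `t𝒲` IN `c′ℛ_k` FROM UNIFORM BOUNDS ON `𝒲`**: if `‖𝒲‖, ‖∂𝒲‖ ≤ K` and `‖δ_α∂𝒲‖ ≤ K·d^α` (the shape of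
*"|𝒲_{k,Ω′}| ≤ C‖C^{1/2}W_k‖_∞ ≤ CB_wp_k … There are similar bounds on derivatives"*, Remark 2 L4494–4495 with (twoone1), (around))
and `|t| ≤ T`, then `t𝒲 ∈ c′ℛ_k(X, ε)` as soon as `T·K < c′λ_k^{−(1/4+ε)}` (the binding clause is the Hölder one; `0 < λ_k ≤ 1`,
`ε ≥ 0`). [cite: Dimock2013BalabanII, §3.13 Lemma 3.15 proof (A) L4505–4511 with Remark 2 L4492–4495 (arXiv:1212.5562v2 TeX)] -/
theorem rDomain_const_mul_of_bounds {K T c' lam ε αH : ℝ} {t : ℂ} {W : X d → ℂ} (hlam : 0 < lam) (hlam1 : lam ≤ 1)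
    (hε : 0 ≤ ε) (hK : 0 ≤ K) (ht : ‖t‖ ≤ T) (hsmall : T * K < c' * lam ^ (-(1 / 4 + ε)))
    (hsup : ∀ x ∈ U n S, ‖W x‖ ≤ K)
    (hder : ∀ μ : Fin d, ∀ x ∈ U n S, x + e μ ∈ U n S → ‖fdFineV n μ W x‖ ≤ K)
    (hH : ∀ μ : Fin d, ∀ x ∈ U n S, ∀ x' ∈ U n S, x + e μ ∈ U n S → x' + e μ ∈ U n S → x ≠ x' →
      dist x x' ≤ (n : ℝ) + 1 → ‖fdFineV n μ W x - fdFineV n μ W x'‖ ≤ K * (dist x x' / ((n : ℝ) + 1)) ^ αH) :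
    RDomain n c' lam ε αH S (fun y => t * W y) := by
  have hmono := rpow_thresholds_mono hlam hlam1 hε
  have hT : 0 ≤ T := (norm_nonneg t).trans ht
  -- `‖t‖·(bound ≤ K) ≤ T·K < c′λ^{−(1/4+ε)}`
  have hmul : ∀ {z : ℂ}, ‖z‖ ≤ K → ‖t * z‖ < c' * lam ^ (-(1 / 4 + ε)) := by
    intro z hz
    rw [norm_mul]
    exact (mul_le_mul ht hz (norm_nonneg _) hT).trans_lt hsmall
  have hc' : 0 ≤ c' := by
    have h0 : 0 ≤ T * K := mul_nonneg hT hK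
    have hp : 0 < lam ^ (-(1 / 4 + ε)) := Real.rpow_pos_of_pos hlam _
    nlinarith [h0.trans_lt hsmall]
  refine ⟨fun x hx => ?_, fun μ x hx hxe => ?_, fun μ x hx x' hx' hxe hxe' hne hdist => ?_⟩
  · exact (hmul (hsup x hx)).trans_le (mul_le_mul_of_nonneg_left (hmono.1.trans hmono.2) hc')
  · rw [fdFineV_const_mul]
    exact (hmul (hder μ x hx hxe)).trans_le (mul_le_mul_of_nonneg_left hmono.1 hc')
  · rw [fdFineV_const_mul, fdFineV_const_mul, ← mul_sub, norm_mul]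
    have hρ : 0 < (dist x x' / ((n : ℝ) + 1)) ^ αH :=
      Real.rpow_pos_of_pos (div_pos (dist_pos.2 hne) (by positivity)) _
    calc ‖t‖ * ‖fdFineV n μ W x - fdFineV n μ W x'‖
        ≤ T * (K * (dist x x' / ((n : ℝ) + 1)) ^ αH) :=
          mul_le_mul ht (hH μ x hx x' hx' hxe hxe' hne hdist) (norm_nonneg _) hT
      _ = (T * K) * (dist x x' / ((n : ℝ) + 1)) ^ αH := by ring
      _ < c' * lam ^ (-(1 / 4 + ε)) * (dist x x' / ((n : ℝ) + 1)) ^ αH := mul_lt_mul_of_pos_right hsmall hρ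

/-- **`t𝒲_{k,Ω′} ∈ ½ℛ_k` ON THE DISC `|t| ≤ λ_k^{−1/4}`** (L4505–4508: *"if |t| ≤ λ_k^{−1/4} we have |t𝒲_{k,Ω′}| ≤ CB_wp_kλ_k^{−1/4} ≤
½λ_k^{−1/4−3ε}. There are similar bounds on derivatives and so t𝒲_{k,Ω′} ∈ ½ℛ_k"*): with `K = CB_wp_k` the uniform bound on `𝒲`
and its derivative∕Hölder quotient, and *"λ_k sufficiently small"* = `2K < λ_k^{−ε}`.
[cite: Dimock2013BalabanII, §3.13 Lemma 3.15 proof (A) L4505–4508 (arXiv:1212.5562v2 TeX)] -/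
theorem tW_mem_half_rDomain {K lam ε αH : ℝ} {t : ℂ} {W : X d → ℂ} (hlam : 0 < lam) (hlam1 : lam ≤ 1) (hε : 0 ≤ ε)
    (hK : 0 ≤ K) (ht : ‖t‖ ≤ lam ^ (-(1 / 4 : ℝ))) (hsmall : 2 * K < lam ^ (-ε))
    (hsup : ∀ x ∈ U n S, ‖W x‖ ≤ K)
    (hder : ∀ μ : Fin d, ∀ x ∈ U n S, x + e μ ∈ U n S → ‖fdFineV n μ W x‖ ≤ K)
    (hH : ∀ μ : Fin d, ∀ x ∈ U n S, ∀ x' ∈ U n S, x + e μ ∈ U n S → x' + e μ ∈ U n S → x ≠ x' →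
      dist x x' ≤ (n : ℝ) + 1 → ‖fdFineV n μ W x - fdFineV n μ W x'‖ ≤ K * (dist x x' / ((n : ℝ) + 1)) ^ αH) :
    RDomain n (1 / 2) lam ε αH S (fun y => t * W y) := by
  refine rDomain_const_mul_of_bounds hlam hlam1 hε hK ht ?_ hsup hder hH
  -- `λ^{−1/4}·K < ½λ^{−(1/4+ε)}` from `2K < λ^{−ε}`
  have hq : 0 < lam ^ (-(1 / 4 : ℝ)) := Real.rpow_pos_of_pos hlam _
  have h1 : lam ^ (-(1 / 4 : ℝ)) * K < lam ^ (-(1 / 4 : ℝ)) * (lam ^ (-ε) / 2) :=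
    mul_lt_mul_of_pos_left (by linarith) hq
  have h2 : lam ^ (-(1 / 4 : ℝ)) * (lam ^ (-ε) / 2) = 1 / 2 * lam ^ (-(1 / 4 + ε)) := by
    rw [show -(1 / 4 + ε) = -(1 / 4 : ℝ) + -ε by ring, Real.rpow_add hlam]; ring
  linarith [h2 ▸ h1]

/-- **THE ANALYTICITY DISC OF LEMMA 3.15 (A)** (L4500–4511: *"We study δE^+_k(X, φ, 𝒲_{k,Ω′}) for φ ∈ ½ℛ_k … t𝒲_{k,Ω′} ∈ ½ℛ_k. Thus
t → E_k(X, φ⁰_{k+1,Ω′} + t𝒲_{k,Ω′}) is analytic in [|t| ≤ λ_k^{−1/4}]"*): `φ ∈ ½ℛ_k` and `t𝒲 ∈ ½ℛ_k` for every `|t| ≤ λ_k^{−1/4}`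
give `φ + t𝒲 ∈ ℛ_k(X, ε)` on the whole closed disc — the field stays in the domain where `E_k(X, ·)` is analytic.
[cite: Dimock2013BalabanII, §3.13 Lemma 3.15 proof (A) L4500–4511 (arXiv:1212.5562v2 TeX)] -/
theorem disc_subset_rDomain {K lam ε αH : ℝ} {φ W : X d → ℂ} (hlam : 0 < lam) (hlam1 : lam ≤ 1) (hε : 0 ≤ ε)
    (hK : 0 ≤ K) (hsmall : 2 * K < lam ^ (-ε)) (hφ : RDomain n (1 / 2) lam ε αH S φ)
    (hsup : ∀ x ∈ U n S, ‖W x‖ ≤ K)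
    (hder : ∀ μ : Fin d, ∀ x ∈ U n S, x + e μ ∈ U n S → ‖fdFineV n μ W x‖ ≤ K)
    (hH : ∀ μ : Fin d, ∀ x ∈ U n S, ∀ x' ∈ U n S, x + e μ ∈ U n S → x' + e μ ∈ U n S → x ≠ x' →
      dist x x' ≤ (n : ℝ) + 1 → ‖fdFineV n μ W x - fdFineV n μ W x'‖ ≤ K * (dist x x' / ((n : ℝ) + 1)) ^ αH)
    {t : ℂ} (ht : ‖t‖ ≤ lam ^ (-(1 / 4 : ℝ))) : RDomain n 1 lam ε αH S (φ + fun y => t * W y) := by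
  have h := rDomain_add hφ (tW_mem_half_rDomain hlam hlam1 hε hK ht hsmall hsup hder hH)
  norm_num at h
  exact h

end Disc

/-! ## Non-vacuity -/

/-- the zero pair is in every class with `q ≥ 0`, `α > 0`.
[cite: Dimock2013BalabanII, §3.2 Definition (lamp) L2245–2258 (arXiv:1212.5562v2 TeX)] -/
theorem zero_mem {n : ℕ} {q α : ℝ} (hq : 0 ≤ q) (hα : 0 < α) (S₀ S : Finset (X d)) :
    LocalFieldBounds n q α S₀ S (0 : X d → E) 0 := by
  refine ⟨fun y _ => ?_, fun μ x _ _ => ?_, fun x _ => ?_⟩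
  · simp [qavgV, hq]
  · simp [fdFineV, hq]
  · simp only [Pi.zero_apply, norm_zero]; positivity

/-- a genuinely complex configuration in `𝒫_k(□, δ)` that is NOT a real one: the constant fine field `i·λ^{−1/4−δ}` with the
matching constant unit field (first clause `0`, derivative `0`, third clause with equality).
[cite: Dimock2013BalabanII, §3.2 Definition (lamp) L2245–2258 (arXiv:1212.5562v2 TeX)] -/
example {n : ℕ} (lam δ : ℝ) (hlam : 0 < lam) (S₀ S : Finset (X d)) :
    PDomain n 1 lam δ S₀ S (fun _ => (Complex.I * (lam ^ (-(1 / 4 + δ)) : ℝ) : ℂ))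
      (fun _ => (Complex.I * (lam ^ (-(1 / 4 + δ)) : ℝ) : ℂ)) := by
  have hq : 0 ≤ lam ^ (-(1 / 4 + δ)) := (Real.rpow_pos_of_pos hlam _).le
  have hQ : ∀ y : X d, qavgV n (fun _ : X d => (Complex.I * (lam ^ (-(1 / 4 + δ)) : ℝ) : ℂ)) y
      = Complex.I * (lam ^ (-(1 / 4 + δ)) : ℝ) := by
    intro y
    have hc : (((n : ℝ) + 1) ^ d) ≠ 0 := by positivity
    rw [qavgV, Finset.sum_const, ← Nat.cast_smul_eq_nsmul ℝ, smul_smul]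
    have hcard : ((B n y).card : ℝ) = ((n : ℝ) + 1) ^ d := card_B_real n y
    rw [hcard, inv_mul_cancel₀ hc, one_smul]
  refine ⟨fun y _ => ?_, fun μ x _ _ => ?_, fun x _ => ?_⟩
  · rw [hQ, sub_self, norm_zero]; positivity
  · simp only [fdFineV, sub_self, smul_zero, norm_zero]; positivity
  · rw [norm_mul, Complex.norm_I, one_mul, Complex.norm_real, Real.norm_of_nonneg hq, inv_one, mul_one, one_mul]

end Literature.MathematicalPhysics.QuantumFieldTheory.Dimock2011to13.AnalyticityDomains

end
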